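import Literature.MathematicalPhysics.QuantumFieldTheory.Balaban1983to89.B6L2BlockSmoothTermsV1
import Literature.MathematicalPhysics.QuantumFieldTheory.Balaban1983to89.B6BlockDecayGDivFactorsV1

/-!
# `Balaban1983to89.B6L2BlockGradDivTermsV1` — T. Bałaban, *Propagators and renormalization transformations for lattice gauge theories. II*,
# Commun. Math. Phys. **96** (1984) 223–250 [Balaban1984PropagatorsII], PROPOSITION 2.5 p. 246, THE PIECES OF `∇_λG∇_μ*` FOR THE TWO-SCALE `G` OF
# (2.90) IN `ℓ²`-BLOCK FORM: `∇_λK₁∇_μ*`, `∇_λH_jQ_j`, `∇_λH_jC̃H_j*∇_μ*`, `∇_λG^{(w′)}`, `G^{(w′)}∇_λ*`, `∇_λK₂*`, `K₂∇_λ*` — uniform row and column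
# block bounds at `c = L^j` and (Schur on blocks, file 23) uniform `ℓ²`-block bounds (file 28a of the unit's `ℓ²` programme; the member
# `‖ζ∇G∇*J‖` of (1.114) is assembled in the sequel file)

statement-level skeleton of published theorems with citation tags; proofs where landed; nothing here is a claim about the Yang–Mills mass gap

p. 246 (verbatim): *"The operator G … has the representation (2.129) and satisfies all the inequalities (1.110)–(1.114) of the Proposition 1.2
with a positive constant δ₂ instead of δ₀."*  [4] (1.114) p. 36: *"… ‖ζ∇G∇*J‖, ‖ζ∇∇GJ‖, ‖ζG∇*∇*J‖ ≤ O(1)e^{−δ₀|y−y′|}|ζ|‖J‖ …"*.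

CITATION HEADER (lean-in-tree rule) — WHAT IS REPRODUCED.  Phase-2 file of the `lit-balaban` typed skeleton (HOME `run/shared/lean/pub/lit-balaban/`),
seat **p22 gen 16**, lane B6 §C (fold owner r03, referee ref-4); SKELETON rows **B6.Prop2.5** / **B6.Eq2.129-2.131** (cells only).  With (2.129)
`G = K₁ + (I − K₂*)M(I − K₂)`, `M = G̃_j + H_jC̃H_j* = G^{(w′)}R₀` (file 25b), `G̃_j = (I − H_jQ_j)G^{(w′)}` (file 6):
`∇_λM∇_μ* = ∇_λG^{(w′)}∇_μ* − (∇_λH_jQ_j)(G^{(w′)}∇_μ*) + ∇_λH_jC̃H_j*∇_μ*`, `∇_λM = (∇_λG^{(w′)})R₀`, `M∇_μ* = (∇_μM)*`.  This file supplies every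
factor except file 24's `∇_λG^{(w′)}∇_μ*` and file 25b's `R₀`, `M`: §0 identities and adjoints (file 1's `K1_eq`, `K1_symm`; p22's `adjoint_Dop`;
file 24's `adjoint_GEW`; file 25b's `adjoint_Ct_V1`); §1 uniform ROW block bounds at the scaling — `∇_λK₁∇_μ* = (∇_λ∂H′)C(∇_μ∂H′)*` (files 8, 13, 4;
file 3's `blockBound_comp3`), `∇_λH_jQ_j` (files 8, 6), `Q_j*(∇_λH_j)*` (files 20, 13), `∇_λH_jC̃H_j*∇_μ* = (∇_λH_j)C̃(∇_μH_j)*` (files 8, 8, 13); every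
power of `n` cancels; §2 the `ℓ²`-BLOCK bounds by file 23's Schur test, columns being the rows of the adjoint: **`l2blk_DK1Dadj_scaling`**,
**`l2blk_DHjQv_scaling`**, **`l2blk_DHjCtHjD_scaling`**, **`l2blk_DGE_scaling`** / **`l2blk_GEDadj_scaling`** (rows: file 8's (1.110)₂ member and
file 12's (1.110)₃ member for `G^{(w′)}`, each the other's columns), **`l2blk_DK2adj_scaling`** / **`l2blk_K2Dadj_scaling`** (rows files 9 and 13, each
the other's columns).  IMPORTS BY NAME, restating nothing.  THEOREMS ONLY; standard axioms.  HONEST SCOPE: bookkeeping at `c = L^j` (weights positive,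
resp. in [4]'s window for the `C̃` term, `w′ = a·n^{d+1}`); constants ours and crude; NOT summit progress.  Unit `lit-balaban-p22` (gen 16), 2026-08-22.
-/

noncomputable section

open scoped InnerProductSpace BigOperators Matrix
open Finset

namespace Literature.MathematicalPhysics.QuantumFieldTheory.Balaban1983to89.B6L2BlockGradDivTermsV1

open LatticeFieldCalculus B5SectBStatements B5Eq117TorusCarriers B6SectADomainsV1 B6SectAOperatorsV1 B6SectAVectorModelV1 B6SectCOperators
  B6SectCTwoScaleV1 B6SectCTwoScaleV1Lattice B5Eq118OneStroke
open BalabanImbrieJaffe1984to88.BIJ85AxialPropagator411 (BondSpace)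
open B4Sect5Torus (IsPseudoDist SumBound)
open B4TorusKernel (periodConst)
open B4TorusKernel.MultiPeriod (torusSupNorm torusSupNorm_nonneg)
open B4Sect5Proof (latticeConst latticeConst_nonneg)
open B5Hk163Strip (kappaN kappaN_pos kappa163 kappa163_pos)
open B5Kernel166Decay (periodConst_pos)
open B6LowerBound2153Torus (rep)
open B6Hprime2132Holder (MGHD)
open B6Repr2129Operator (K1_eq K1_symm)
open B6BlockDecayCalculus (blockBound_comp blockBound_mono torusDist_isPseudoDist torusDist_sumBound)
open B6BlockDecayHprimeCovV1 (MGHD_nonneg blockBound_C_of_entry cov_entry_uniform)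
open B6BlockDecayK12V1 (blockBound_comp3)
open B5Hk163TorusHolderDecay (CdecD CdecD_nonneg)
open B6BlockDecayGtV1 (blockBound_Qv)
open B6BlockDecayGradFactorsV1 (blockBound_DgradHp blockBound_DHj blockBound_Ct_scaling blockBound_DGE_scaling)
open B6BlockDecayGradCompositesV1 (blockBound_DK2adj_scaling)
open B6BlockDecayGDivBridgeV1 (adjoint_Dop blockBound_GEDadj_scaling)
open B6BlockDecayGDivFactorsV1 (blockBound_DgradHp_adjoint blockBound_DHj_adjoint blockBound_K2Dadj_scaling)
open B6BlockDecayLapHjV1 (blockBound_Qv_adjoint)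
open B6L2BlockCalculus (l2blk_of_blockBounds)
open B6L2Block114GEV1 (adjoint_GEW)
open B6L2BlockSmoothTermsV1 (blockBound_comp2r adjoint_Ct_V1)

variable {d L m K : ℕ} {hd : 1 ≤ d + 1} {hL : Odd L ∧ 1 < L} {j : ℕ}

/-! ## §0  Identities and adjoints -/

section Identities

variable (hc : ((L : ℝ) ^ j) ≠ 0) (hj : j + 1 ≤ (⟨d + 1, L, m, K, hd, hL⟩ : Params).m + (⟨d + 1, L, m, K, hd, hL⟩ : Params).K) (Λ' : Finset (Site (⟨d + 1, L, m, K, hd, hL⟩ : Params) (j + 1))) {w : CIdx j Λ' → ℝ} (hw : ∀ i, 0 < w i)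

/-- `(∇_λ*)* = ∇_λ` (p22's `adjoint_Dop`). [cite: Balaban1984PropagatorsI, (1.89) p.33, (1.4) p.18] -/
theorem adjoint_Dadj (lam : Fin (d + 1)) : LinearMap.adjoint ((((L : ℝ) ^ j) • (onE (LinearMap.funLeft ℝ ℝ (fun b : PBond (⟨d + 1, L, m, K, hd, hL⟩ : Params) 0 => (⟨b.src.unshift lam, b.dir⟩ : PBond (⟨d + 1, L, m, K, hd, hL⟩ : Params) 0))) - LinearMap.id) : BondSpace (⟨d + 1, L, m, K, hd, hL⟩ : Params) →ₗ[ℝ] BondSpace (⟨d + 1, L, m, K, hd, hL⟩ : Params))) = ((((L : ℝ) ^ j) • (onE (LinearMap.funLeft ℝ ℝ (fun b : PBond (⟨d + 1, L, m, K, hd, hL⟩ : Params) 0 => (⟨b.src.shift lam, b.dir⟩ : PBond (⟨d + 1, L, m, K, hd, hL⟩ : Params) 0))) - LinearMap.id) : BondSpace (⟨d + 1, L, m, K, hd, hL⟩ : Params) →ₗ[ℝ] BondSpace (⟨d + 1, L, m, K, hd, hL⟩ : Params))) := by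
  rw [← adjoint_Dop, LinearMap.adjoint_adjoint]

include hj hw in
/-- `K₁* = K₁` (file 1's `K1_symm`). [cite: Balaban1984PropagatorsII, (2.129) p.246] -/
theorem adjoint_K1_V1 : LinearMap.adjoint (tsV1 hc Λ' w).K1 = (tsV1 hc Λ' w).K1 :=
  ((LinearMap.eq_adjoint_iff _ _).2 fun x y => K1_symm (isLattice Λ' hc hj hw) (positive Λ' hc hj w) x y).symm

include hj hw in
/-- `∇_λK₁∇_μ* = (∇_λ∂H′_j)·(C^{(j)}_Λ(∇_μ∂H′_j)*)` (file 1's `K1_eq`, `(∂H′_j)*∇_μ* = (∇_μ∂H′_j)*`). [cite: Balaban1984PropagatorsII, (2.129) p.246] -/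
theorem DK1Dadj_eq (lam mu : Fin (d + 1)) : (((((L : ℝ) ^ j) • (onE (LinearMap.funLeft ℝ ℝ (fun b : PBond (⟨d + 1, L, m, K, hd, hL⟩ : Params) 0 => (⟨b.src.shift lam, b.dir⟩ : PBond (⟨d + 1, L, m, K, hd, hL⟩ : Params) 0))) - LinearMap.id) : BondSpace (⟨d + 1, L, m, K, hd, hL⟩ : Params) →ₗ[ℝ] BondSpace (⟨d + 1, L, m, K, hd, hL⟩ : Params))) ∘ₗ (tsV1 hc Λ' w).K1 ∘ₗ ((((L : ℝ) ^ j) • (onE (LinearMap.funLeft ℝ ℝ (fun b : PBond (⟨d + 1, L, m, K, hd, hL⟩ : Params) 0 => (⟨b.src.unshift mu, b.dir⟩ : PBond (⟨d + 1, L, m, K, hd, hL⟩ : Params) 0))) - LinearMap.id) : BondSpace (⟨d + 1, L, m, K, hd, hL⟩ : Params) →ₗ[ℝ] BondSpace (⟨d + 1, L, m, K, hd, hL⟩ : Params)))) = (((((L : ℝ) ^ j) • (onE (LinearMap.funLeft ℝ ℝ (fun b : PBond (⟨d + 1, L, m, K, hd, hL⟩ : Params) 0 => (⟨b.src.shift lam,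 b.dir⟩ : PBond (⟨d + 1, L, m, K, hd, hL⟩ : Params) 0))) - LinearMap.id) : BondSpace (⟨d + 1, L, m, K, hd, hL⟩ : Params) →ₗ[ℝ] BondSpace (⟨d + 1, L, m, K, hd, hL⟩ : Params))) ∘ₗ ((tsV1 hc Λ' w).grad ∘ₗ (tsV1 hc Λ' w).hP)) ∘ₗ ((tsV1 hc Λ' w).C ∘ₗ LinearMap.adjoint (((((L : ℝ) ^ j) • (onE (LinearMap.funLeft ℝ ℝ (fun b : PBond (⟨d + 1, L, m, K, hd, hL⟩ : Params) 0 => (⟨b.src.shift mu, b.dir⟩ : PBond (⟨d + 1, L, m, K, hd, hL⟩ : Params) 0))) - LinearMap.id) : BondSpace (⟨d + 1, L, m, K, hd, hL⟩ : Params) →ₗ[ℝ] BondSpace (⟨d + 1, L, m, K, hd, hL⟩ : Params))) ∘ₗ ((tsV1 hc Λ' w).grad ∘ₗ (tsV1 hc Λ' w).hP))) := by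
  rw [K1_eq (isLattice Λ' hc hj hw), LinearMap.adjoint_comp ((((L : ℝ) ^ j) • (onE (LinearMap.funLeft ℝ ℝ (fun b : PBond (⟨d + 1, L, m, K, hd, hL⟩ : Params) 0 => (⟨b.src.shift mu, b.dir⟩ : PBond (⟨d + 1, L, m, K, hd, hL⟩ : Params) 0))) - LinearMap.id) : BondSpace (⟨d + 1, L, m, K, hd, hL⟩ : Params) →ₗ[ℝ] BondSpace (⟨d + 1, L, m, K, hd, hL⟩ : Params))), adjoint_Dop]
  simp only [LinearMap.comp_assoc]

include hj hw in
/-- `(∇_λK₁∇_μ*)* = ∇_μK₁∇_λ*`. [cite: Balaban1984PropagatorsII, (2.129) p.246] -/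
theorem adjoint_DK1Dadj_eq (lam mu : Fin (d + 1)) : LinearMap.adjoint (((((L : ℝ) ^ j) • (onE (LinearMap.funLeft ℝ ℝ (fun b : PBond (⟨d + 1, L, m, K, hd, hL⟩ : Params) 0 => (⟨b.src.shift lam, b.dir⟩ : PBond (⟨d + 1, L, m, K, hd, hL⟩ : Params) 0))) - LinearMap.id) : BondSpace (⟨d + 1, L, m, K, hd, hL⟩ : Params) →ₗ[ℝ] BondSpace (⟨d + 1, L, m, K, hd, hL⟩ : Params))) ∘ₗ (tsV1 hc Λ' w).K1 ∘ₗ ((((L : ℝ) ^ j) • (onE (LinearMap.funLeft ℝ ℝ (fun b : PBond (⟨d + 1, L, m, K, hd, hL⟩ : Params) 0 => (⟨b.src.unshift mu, b.dir⟩ : PBond (⟨d + 1, L, m, K, hd, hL⟩ : Params) 0))) - LinearMap.id) : BondSpace (⟨d + 1, L, m, K, hd, hL⟩ : Params) →ₗ[ℝ] BondSpace (⟨d + 1, L, m, K, hd, hL⟩ : Params)))) = (((((L : ℝ) ^ j) • (onE (LinearMap.funLeft ℝ ℝ (fun b : PBond (⟨d + 1, L, m, K, hd, hL⟩ : Params)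 0 => (⟨b.src.shift mu, b.dir⟩ : PBond (⟨d + 1, L, m, K, hd, hL⟩ : Params) 0))) - LinearMap.id) : BondSpace (⟨d + 1, L, m, K, hd, hL⟩ : Params) →ₗ[ℝ] BondSpace (⟨d + 1, L, m, K, hd, hL⟩ : Params))) ∘ₗ (tsV1 hc Λ' w).K1 ∘ₗ ((((L : ℝ) ^ j) • (onE (LinearMap.funLeft ℝ ℝ (fun b : PBond (⟨d + 1, L, m, K, hd, hL⟩ : Params) 0 => (⟨b.src.unshift lam, b.dir⟩ : PBond (⟨d + 1, L, m, K, hd, hL⟩ : Params) 0))) - LinearMap.id) : BondSpace (⟨d + 1, L, m, K, hd, hL⟩ : Params) →ₗ[ℝ] BondSpace (⟨d + 1, L, m, K, hd, hL⟩ : Params)))) := by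
  rw [LinearMap.adjoint_comp, LinearMap.adjoint_comp, adjoint_Dadj, adjoint_K1_V1 hc hj Λ' hw, adjoint_Dop, LinearMap.comp_assoc]

/-- `∇_λH_jQ_j = (∇_λH_j)Q_j`. [cite: Balaban1984PropagatorsII, (2.131) p.246] -/
theorem DHjQv_eq (lam : Fin (d + 1)) : (((((L : ℝ) ^ j) • (onE (LinearMap.funLeft ℝ ℝ (fun b : PBond (⟨d + 1, L, m, K, hd, hL⟩ : Params) 0 => (⟨b.src.shift lam, b.dir⟩ : PBond (⟨d + 1, L, m, K, hd, hL⟩ : Params) 0))) - LinearMap.id) : BondSpace (⟨d + 1, L, m, K, hd, hL⟩ : Params) →ₗ[ℝ] BondSpace (⟨d + 1, L, m, K, hd, hL⟩ : Params))) ∘ₗ (tsV1 hc Λ' w).Hj ∘ₗ (tsV1 hc Λ' w).Qv) = (((((L : ℝ) ^ j) • (onE (LinearMap.funLeft ℝ ℝ (fun b : PBond (⟨d + 1, L, m, K, hd, hL⟩ : Params) 0 => (⟨b.src.shift lam, b.dir⟩ : PBond (⟨d + 1, L, m, K, hd, hL⟩ : Params) 0))) - LinearMap.id) : BondSpace (⟨d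 + 1, L, m, K, hd, hL⟩ : Params) →ₗ[ℝ] BondSpace (⟨d + 1, L, m, K, hd, hL⟩ : Params))) ∘ₗ (tsV1 hc Λ' w).Hj) ∘ₗ (tsV1 hc Λ' w).Qv := (LinearMap.comp_assoc _ _ _).symm

/-- `(∇_λH_jQ_j)* = Q_j*(∇_λH_j)*`. [cite: Balaban1984PropagatorsII, (2.131) p.246] -/
theorem adjoint_DHjQv_eq (lam : Fin (d + 1)) : LinearMap.adjoint (((((L : ℝ) ^ j) • (onE (LinearMap.funLeft ℝ ℝ (fun b : PBond (⟨d + 1, L, m, K, hd, hL⟩ : Params) 0 => (⟨b.src.shift lam, b.dir⟩ : PBond (⟨d + 1, L, m, K, hd, hL⟩ : Params) 0))) - LinearMap.id) : BondSpace (⟨d + 1, L, m, K, hd, hL⟩ : Params) →ₗ[ℝ] BondSpace (⟨d + 1, L, m, K, hd, hL⟩ : Params))) ∘ₗ (tsV1 hc Λ' w).Hj ∘ₗ (tsV1 hc Λ' w).Qv) = (LinearMap.adjoint (tsV1 hc Λ' w).Qv ∘ₗ LinearMap.adjoint (((((L : ℝ) ^ j) • (onE (LinearMap.funLeft ℝ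 ℝ (fun b : PBond (⟨d + 1, L, m, K, hd, hL⟩ : Params) 0 => (⟨b.src.shift lam, b.dir⟩ : PBond (⟨d + 1, L, m, K, hd, hL⟩ : Params) 0))) - LinearMap.id) : BondSpace (⟨d + 1, L, m, K, hd, hL⟩ : Params) →ₗ[ℝ] BondSpace (⟨d + 1, L, m, K, hd, hL⟩ : Params))) ∘ₗ (tsV1 hc Λ' w).Hj)) := by
  rw [DHjQv_eq, LinearMap.adjoint_comp]

/-- `∇_λH_jC̃H_j*∇_μ* = (∇_λH_j)·(C̃(∇_μH_j)*)`. [cite: Balaban1984PropagatorsII, (2.129) p.246] -/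
theorem DHjCtHjD_eq (lam mu : Fin (d + 1)) : (((((L : ℝ) ^ j) • (onE (LinearMap.funLeft ℝ ℝ (fun b : PBond (⟨d + 1, L, m, K, hd, hL⟩ : Params) 0 => (⟨b.src.shift lam, b.dir⟩ : PBond (⟨d + 1, L, m, K, hd, hL⟩ : Params) 0))) - LinearMap.id) : BondSpace (⟨d + 1, L, m, K, hd, hL⟩ : Params) →ₗ[ℝ] BondSpace (⟨d + 1, L, m, K, hd, hL⟩ : Params))) ∘ₗ (tsV1 hc Λ' w).Hj ∘ₗ (tsV1 hc Λ' w).Ct ∘ₗ LinearMap.adjoint (tsV1 hc Λ' w).Hj ∘ₗ ((((L : ℝ) ^ j) • (onE (LinearMap.funLeft ℝ ℝ (fun b : PBond (⟨d + 1, L, m, K, hd, hL⟩ : Params) 0 => (⟨b.src.unshift mu, b.dir⟩ : PBond (⟨d + 1, L, m, K, hd, hL⟩ : Params) 0))) - LinearMap.id) : BondSpace (⟨d + 1, L, m, K, hd, hL⟩ : Params) →ₗ[ℝ] BondSpace (⟨d + 1, L, m, K, hd, hL⟩ : Params)))) = (((((L : ℝ) ^ j) • (onE (LinearMap.funLeft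 ℝ ℝ (fun b : PBond (⟨d + 1, L, m, K, hd, hL⟩ : Params) 0 => (⟨b.src.shift lam, b.dir⟩ : PBond (⟨d + 1, L, m, K, hd, hL⟩ : Params) 0))) - LinearMap.id) : BondSpace (⟨d + 1, L, m, K, hd, hL⟩ : Params) →ₗ[ℝ] BondSpace (⟨d + 1, L, m, K, hd, hL⟩ : Params))) ∘ₗ (tsV1 hc Λ' w).Hj) ∘ₗ ((tsV1 hc Λ' w).Ct ∘ₗ LinearMap.adjoint (((((L : ℝ) ^ j) • (onE (LinearMap.funLeft ℝ ℝ (fun b : PBond (⟨d + 1, L, m, K, hd, hL⟩ : Params) 0 => (⟨b.src.shift mu, b.dir⟩ : PBond (⟨d + 1, L, m, K, hd, hL⟩ : Params) 0))) - LinearMap.id) : BondSpace (⟨d + 1, L, m, K, hd, hL⟩ : Params) →ₗ[ℝ] BondSpace (⟨d + 1, L, m, K, hd, hL⟩ : Params))) ∘ₗ (tsV1 hc Λ' w).Hj)) := by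
  rw [LinearMap.adjoint_comp, adjoint_Dop]
  simp only [LinearMap.comp_assoc]

include hj hw in
/-- `(∇_λH_jC̃H_j*∇_μ*)* = ∇_μH_jC̃H_j*∇_λ*` (`C̃* = C̃`, file 25b). [cite: Balaban1984PropagatorsII, (2.129) p.246] -/
theorem adjoint_DHjCtHjD_eq (lam mu : Fin (d + 1)) : LinearMap.adjoint (((((L : ℝ) ^ j) • (onE (LinearMap.funLeft ℝ ℝ (fun b : PBond (⟨d + 1, L, m, K, hd, hL⟩ : Params) 0 => (⟨b.src.shift lam, b.dir⟩ : PBond (⟨d + 1, L, m, K, hd, hL⟩ : Params) 0))) - LinearMap.id) : BondSpace (⟨d + 1, L, m, K, hd, hL⟩ : Params) →ₗ[ℝ] BondSpace (⟨d + 1, L, m, K, hd, hL⟩ : Params))) ∘ₗ (tsV1 hc Λ' w).Hj ∘ₗ (tsV1 hc Λ' w).Ct ∘ₗ LinearMap.adjoint (tsV1 hc Λ' w).Hj ∘ₗ ((((L : ℝ) ^ j) • (onE (LinearMap.funLeft ℝ ℝ (fun b : PBond (⟨d + 1, L, m, K, hd, hL⟩ : Params) 0 => (⟨b.src.unshift mu,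 b.dir⟩ : PBond (⟨d + 1, L, m, K, hd, hL⟩ : Params) 0))) - LinearMap.id) : BondSpace (⟨d + 1, L, m, K, hd, hL⟩ : Params) →ₗ[ℝ] BondSpace (⟨d + 1, L, m, K, hd, hL⟩ : Params)))) = (((((L : ℝ) ^ j) • (onE (LinearMap.funLeft ℝ ℝ (fun b : PBond (⟨d + 1, L, m, K, hd, hL⟩ : Params) 0 => (⟨b.src.shift mu, b.dir⟩ : PBond (⟨d + 1, L, m, K, hd, hL⟩ : Params) 0))) - LinearMap.id) : BondSpace (⟨d + 1, L, m, K, hd, hL⟩ : Params) →ₗ[ℝ] BondSpace (⟨d + 1, L, m, K, hd, hL⟩ : Params))) ∘ₗ (tsV1 hc Λ' w).Hj ∘ₗ (tsV1 hc Λ' w).Ct ∘ₗ LinearMap.adjoint (tsV1 hc Λ' w).Hj ∘ₗ ((((L : ℝ) ^ j) • (onE (LinearMap.funLeft ℝ ℝ (fun b : PBond (⟨d + 1, L, m, K, hd, hL⟩ : Params) 0 => (⟨b.src.unshift lam, b.dir⟩ : PBond (⟨d + 1, L, m, K, hd, hL⟩ : Params) 0))) - LinearMap.id) : BondSpace (⟨d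 + 1, L, m, K, hd, hL⟩ : Params) →ₗ[ℝ] BondSpace (⟨d + 1, L, m, K, hd, hL⟩ : Params)))) := by
  rw [LinearMap.adjoint_comp, LinearMap.adjoint_comp, LinearMap.adjoint_comp, LinearMap.adjoint_comp, LinearMap.adjoint_adjoint,
    adjoint_Ct_V1 hc hj Λ' hw, adjoint_Dadj, adjoint_Dop]
  simp only [LinearMap.comp_assoc]

/-- `(∇_λK₂*)* = K₂∇_λ*`. [cite: Balaban1984PropagatorsII, (2.129) p.246] -/
theorem adjoint_DK2adj_eq (lam : Fin (d + 1)) : LinearMap.adjoint (((((L : ℝ) ^ j) • (onE (LinearMap.funLeft ℝ ℝ (fun b : PBond (⟨d + 1, L, m, K, hd, hL⟩ : Params) 0 => (⟨b.src.shift lam, b.dir⟩ : PBond (⟨d + 1, L, m, K, hd, hL⟩ : Params) 0))) - LinearMap.id) : BondSpace (⟨d + 1, L, m, K, hd, hL⟩ : Params) →ₗ[ℝ] BondSpace (⟨d + 1, L, m, K, hd, hL⟩ : Params))) ∘ₗ LinearMap.adjoint (tsV1 hc Λ' w).K2) = ((tsV1 hc Λ' w).K2 ∘ₗ ((((L : ℝ)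 ^ j) • (onE (LinearMap.funLeft ℝ ℝ (fun b : PBond (⟨d + 1, L, m, K, hd, hL⟩ : Params) 0 => (⟨b.src.unshift lam, b.dir⟩ : PBond (⟨d + 1, L, m, K, hd, hL⟩ : Params) 0))) - LinearMap.id) : BondSpace (⟨d + 1, L, m, K, hd, hL⟩ : Params) →ₗ[ℝ] BondSpace (⟨d + 1, L, m, K, hd, hL⟩ : Params)))) := by
  rw [LinearMap.adjoint_comp, LinearMap.adjoint_adjoint, adjoint_Dop]

/-- `(K₂∇_λ*)* = ∇_λK₂*`. [cite: Balaban1984PropagatorsII, (2.129) p.246] -/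
theorem adjoint_K2Dadj_eq (lam : Fin (d + 1)) : LinearMap.adjoint ((tsV1 hc Λ' w).K2 ∘ₗ ((((L : ℝ) ^ j) • (onE (LinearMap.funLeft ℝ ℝ (fun b : PBond (⟨d + 1, L, m, K, hd, hL⟩ : Params) 0 => (⟨b.src.unshift lam, b.dir⟩ : PBond (⟨d + 1, L, m, K, hd, hL⟩ : Params) 0))) - LinearMap.id) : BondSpace (⟨d + 1, L, m, K, hd, hL⟩ : Params) →ₗ[ℝ] BondSpace (⟨d + 1, L, m, K, hd, hL⟩ : Params)))) = (((((L : ℝ) ^ j) • (onE (LinearMap.funLeft ℝ ℝ (fun b : PBond (⟨d + 1, L, m, K, hd, hL⟩ : Params) 0 => (⟨b.src.shift lam, b.dir⟩ : PBond (⟨d + 1, L, m, K, hd, hL⟩ : Params) 0))) - LinearMap.id) : BondSpace (⟨d + 1, L, m, K, hd, hL⟩ : Params) →ₗ[ℝ] BondSpace (⟨d + 1, L, m, K, hd, hL⟩ : Params))) ∘ₗ LinearMap.adjoint (tsV1 hc Λ' w).K2) := by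
  rw [LinearMap.adjoint_comp, adjoint_Dadj]

end Identities

section IdentitiesGE

variable [NeZero L] (hj' : j ≤ (⟨d + 1, L, m, K, hd, hL⟩ : Params).m + (⟨d + 1, L, m, K, hd, hL⟩ : Params).K) (hc : ((L : ℝ) ^ j) ≠ 0) {a : ℝ} (hw' : (0 : ℝ) < a * ((L : ℝ) ^ j) ^ (d + 1))

omit [NeZero L] in
/-- `(∇_λG^{(w′)})* = G^{(w′)}∇_λ*` (file 24's `adjoint_GEW`). [cite: Balaban1984PropagatorsII, (2.22) p.226; Balaban1984PropagatorsI, (1.89) p.33] -/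
theorem adjoint_DGE_eq (lam : Fin (d + 1)) : LinearMap.adjoint (((((L : ℝ) ^ j) • (onE (LinearMap.funLeft ℝ ℝ (fun b : PBond (⟨d + 1, L, m, K, hd, hL⟩ : Params) 0 => (⟨b.src.shift lam, b.dir⟩ : PBond (⟨d + 1, L, m, K, hd, hL⟩ : Params) 0))) - LinearMap.id) : BondSpace (⟨d + 1, L, m, K, hd, hL⟩ : Params) →ₗ[ℝ] BondSpace (⟨d + 1, L, m, K, hd, hL⟩ : Params))) ∘ₗ (GE (Domains.whole (P := (⟨d + 1, L, m, K, hd, hL⟩ : Params)) j hj') hc (w := fun _ => a * ((L : ℝ) ^ j) ^ (d + 1)) (fun _ => hw'))) = ((GE (Domains.whole (P := (⟨d + 1, L, m, K, hd, hL⟩ : Params)) j hj') hc (w := fun _ => a * ((L : ℝ) ^ j) ^ (d + 1)) (fun _ => hw')) ∘ₗ ((((L : ℝ) ^ j) • (onE (LinearMap.funLeft ℝ ℝ (fun b : PBond (⟨d + 1, L, m, K, hd, hL⟩ : Params) 0 => (⟨b.src.unshift lam, b.dir⟩ : PBond (⟨d + 1, L, m, K, hd, hL⟩ : Params) 0)))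 - LinearMap.id) : BondSpace (⟨d + 1, L, m, K, hd, hL⟩ : Params) →ₗ[ℝ] BondSpace (⟨d + 1, L, m, K, hd, hL⟩ : Params)))) := by
  rw [LinearMap.adjoint_comp, adjoint_GEW, adjoint_Dop]

omit [NeZero L] in
/-- `(G^{(w′)}∇_λ*)* = ∇_λG^{(w′)}`. [cite: Balaban1984PropagatorsII, (2.22) p.226; Balaban1984PropagatorsI, (1.89) p.33] -/
theorem adjoint_GEDadj_eq (lam : Fin (d + 1)) : LinearMap.adjoint ((GE (Domains.whole (P := (⟨d + 1, L, m, K, hd, hL⟩ : Params)) j hj') hc (w := fun _ => a * ((L : ℝ) ^ j) ^ (d + 1)) (fun _ => hw')) ∘ₗ ((((L : ℝ) ^ j) • (onE (LinearMap.funLeft ℝ ℝ (fun b : PBond (⟨d + 1, L, m, K, hd, hL⟩ : Params) 0 => (⟨b.src.unshift lam, b.dir⟩ : PBond (⟨d + 1, L, m, K, hd, hL⟩ : Params) 0))) - LinearMap.id) : BondSpace (⟨d + 1, L, m, K, hd, hL⟩ : Params) →ₗ[ℝ] BondSpace (⟨d + 1, L, m, K, hd, hL⟩ : Params)))) = (((((L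 : ℝ) ^ j) • (onE (LinearMap.funLeft ℝ ℝ (fun b : PBond (⟨d + 1, L, m, K, hd, hL⟩ : Params) 0 => (⟨b.src.shift lam, b.dir⟩ : PBond (⟨d + 1, L, m, K, hd, hL⟩ : Params) 0))) - LinearMap.id) : BondSpace (⟨d + 1, L, m, K, hd, hL⟩ : Params) →ₗ[ℝ] BondSpace (⟨d + 1, L, m, K, hd, hL⟩ : Params))) ∘ₗ (GE (Domains.whole (P := (⟨d + 1, L, m, K, hd, hL⟩ : Params)) j hj') hc (w := fun _ => a * ((L : ℝ) ^ j) ^ (d + 1)) (fun _ => hw'))) := by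
  rw [LinearMap.adjoint_comp, adjoint_Dadj, adjoint_GEW]

end IdentitiesGE

/-! ## §1  Uniform row block bounds at the scaling -/

section Rows

open Classical in
/-- **`∇_λK₁∇_μ* = (∇_λ∂H′_j)C^{(j)}_Λ(∇_μ∂H′_j)*` HAS AN EXPONENTIALLY DECAYING BLOCK KERNEL, UNIFORMLY** (at `c = L^j`): `∇_λ∂H′_j` `(A₂, κ)` (file 8),
`C^{(j)}_Λ` `(E/n^{d+1}, δ_C)` (file 4), `(∇_μ∂H′_j)*` `(A₂n^{d+1}(d+1), κ)` (file 13). [cite: Balaban1984PropagatorsII, Prop. 2.5 p.246] -/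
theorem blockBound_DK1Dadj_scaling (d L : ℕ) (hd : 1 ≤ d + 1) (hL : Odd L ∧ 1 < L) :
    ∃ δ : ℝ, 0 < δ ∧ ∃ C : ℝ, 0 ≤ C ∧ ∀ (m K : ℕ) (j : ℕ) (hc : ((L : ℝ) ^ j) ≠ 0)
      (_hj : j + 1 ≤ (⟨d + 1, L, m, K, hd, hL⟩ : Params).m + (⟨d + 1, L, m, K, hd, hL⟩ : Params).K)
      (Λ' : Finset (Site (⟨d + 1, L, m, K, hd, hL⟩ : Params) (j + 1))) (w : CIdx j Λ' → ℝ) (_hw : ∀ i, 0 < w i) (lam mu : Fin (d + 1))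
      (b₀ : PBond (⟨d + 1, L, m, K, hd, hL⟩ : Params) 0) (y : Site (⟨d + 1, L, m, K, hd, hL⟩ : Params) j),
      ∑ b₀' ∈ univ.filter (fun b₀' : PBond (⟨d + 1, L, m, K, hd, hL⟩ : Params) 0 => iterBlockOf j b₀'.src = y),
          |(((((L : ℝ) ^ j) • (onE (LinearMap.funLeft ℝ ℝ (fun b : PBond (⟨d + 1, L, m, K, hd, hL⟩ : Params) 0 => (⟨b.src.shift lam, b.dir⟩ : PBond (⟨d + 1, L, m, K, hd, hL⟩ : Params) 0))) - LinearMap.id) : BondSpace (⟨d + 1, L, m, K, hd, hL⟩ : Params) →ₗ[ℝ] BondSpace (⟨d + 1, L, m, K, hd, hL⟩ : Params))) ∘ₗ (tsV1 hc Λ' w).K1 ∘ₗ ((((L : ℝ) ^ j) • (onE (LinearMap.funLeft ℝ ℝ (fun b : PBond (⟨d + 1, L, m, K, hd, hL⟩ : Params) 0 => (⟨b.src.unshift mu, b.dir⟩ : PBond (⟨d + 1, L, m, K, hd, hL⟩ : Params) 0))) - LinearMap.id) : BondSpace (⟨d + 1, L, m, K, hd, hL⟩ : Params) →ₗ[ℝ]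 BondSpace (⟨d + 1, L, m, K, hd, hL⟩ : Params)))) (EuclideanSpace.single b₀' (1 : ℝ)) b₀| ≤
        C * Real.exp (-(δ * torusSupNorm (Mk (⟨d + 1, L, m, K, hd, hL⟩ : Params) j) (rep (Mk (⟨d + 1, L, m, K, hd, hL⟩ : Params) j) (iterBlockOf j b₀.src) - rep (Mk (⟨d + 1, L, m, K, hd, hL⟩ : Params) j) y))) := by
  obtain ⟨δC, hδC, E, hE, hCov⟩ := cov_entry_uniform d L hd hL
  set κH : ℝ := kappaN (d + 1) / ((d : ℝ) + 1) with hκH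
  have hκH0 : 0 < κH := div_pos (kappaN_pos _) (by positivity)
  set δ₁ : ℝ := min (δC / 2) κH with hδ₁
  set δ₂ : ℝ := min (δC / 2) (κH / 2) with hδ₂
  have hδ₁0 : 0 < δ₁ := lt_min (half_pos hδC) hκH0
  have hδ₂0 : 0 < δ₂ := lt_min (half_pos hδC) (half_pos hκH0)
  have hδ₁C : δ₁ < δC := lt_of_le_of_lt (min_le_left _ _) (half_lt_self hδC)
  have hδ₁H : δ₁ ≤ κH := min_le_right _ _
  have hδ₂₁ : δ₂ ≤ δ₁ := le_min (min_le_left _ _) ((min_le_right _ _).trans (half_le_self hκH0.le))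
  have hδ₂H : δ₂ < κH := lt_of_le_of_lt (min_le_right _ _) (half_lt_self hκH0)
  set K₁ : ℝ := latticeConst (d + 1) (δC - δ₁) with hK₁
  set K₂ : ℝ := latticeConst (d + 1) (κH - δ₂) with hK₂
  have hK₁0 : 0 ≤ K₁ := latticeConst_nonneg _ (by linarith)
  have hK₂0 : 0 ≤ K₂ := latticeConst_nonneg _ (by linarith)
  have hL0 : 0 < L := by have := hL.2; omega
  haveI : NeZero L := ⟨by omega⟩
  have hLp : (0 : ℝ) < L := by exact_mod_cast hL0
  set A₂ : ℝ := MGHD (d + 1) 2 * periodConst (kappaN (d + 1)) d with hA₂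
  have hA₂0 : 0 ≤ A₂ := mul_nonneg (MGHD_nonneg _ _) (periodConst_pos (kappaN_pos _) _).le
  set C : ℝ := A₂ * (E * (A₂ * ((d + 1 : ℕ) : ℝ)) * K₁) * K₂ with hC
  have hC0 : 0 ≤ C := by positivity
  refine ⟨δ₂, hδ₂0, C, hC0, ?_⟩
  intro m K j hc hj Λ' w hw lam mu b₀ y
  have hj' : j ≤ m + K := Nat.le_of_succ_le hj
  set n : ℝ := ((L : ℝ) ^ j) ^ (d + 1) with hn
  have hn0 : 0 < n := by positivity
  have hLj : (0 : ℝ) < (L : ℝ) ^ j := by positivity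
  have hρ : IsPseudoDist (fun t t' : Site (⟨d + 1, L, m, K, hd, hL⟩ : Params) j => torusSupNorm (Mk (⟨d + 1, L, m, K, hd, hL⟩ : Params) j) (rep (Mk (⟨d + 1, L, m, K, hd, hL⟩ : Params) j) t - rep (Mk (⟨d + 1, L, m, K, hd, hL⟩ : Params) j) t')) := torusDist_isPseudoDist (Mk (⟨d + 1, L, m, K, hd, hL⟩ : Params) j)
  have hK : SumBound (fun t t' : Site (⟨d + 1, L, m, K, hd, hL⟩ : Params) j => torusSupNorm (Mk (⟨d + 1, L, m, K, hd, hL⟩ : Params) j) (rep (Mk (⟨d + 1, L, m, K, hd, hL⟩ : Params) j) t - rep (Mk (⟨d + 1, L, m, K, hd, hL⟩ : Params) j) t')) (fun a => latticeConst (d + 1) a) := torusDist_sumBound (Mk (⟨d + 1, L, m, K, hd, hL⟩ : Params) j)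
  have h1 : |(L : ℝ) ^ j| / (L : ℝ) ^ j = 1 := by rw [abs_of_pos hLj, div_self hc]
  have hcast : (((L ^ j) ^ (d + 1) * (d + 1) : ℕ) : ℝ) = n * ((d + 1 : ℕ) : ℝ) := by rw [hn]; push_cast; ring
  have hθ : ((L : ℝ) ^ j / (L : ℝ) ^ j) ^ 4 * ((L : ℝ) ^ j) ^ (d + 1) = n := by rw [div_self hc, one_pow, one_mul]
  have hT : ∀ (b₀ : PBond (⟨d + 1, L, m, K, hd, hL⟩ : Params) 0) (y : Site (⟨d + 1, L, m, K, hd, hL⟩ : Params) j),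
      ∑ y' ∈ univ.filter (fun y' : Site (⟨d + 1, L, m, K, hd, hL⟩ : Params) j => y' = y), |(((((L : ℝ) ^ j) • (onE (LinearMap.funLeft ℝ ℝ (fun b : PBond (⟨d + 1, L, m, K, hd, hL⟩ : Params) 0 => (⟨b.src.shift lam, b.dir⟩ : PBond (⟨d + 1, L, m, K, hd, hL⟩ : Params) 0))) - LinearMap.id) : BondSpace (⟨d + 1, L, m, K, hd, hL⟩ : Params) →ₗ[ℝ] BondSpace (⟨d + 1, L, m, K, hd, hL⟩ : Params))) ∘ₗ ((tsV1 hc Λ' w).grad ∘ₗ (tsV1 hc Λ' w).hP)) (EuclideanSpace.single y' (1 : ℝ)) b₀| ≤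
        A₂ * Real.exp (-(κH * torusSupNorm (Mk (⟨d + 1, L, m, K, hd, hL⟩ : Params) j) (rep (Mk (⟨d + 1, L, m, K, hd, hL⟩ : Params) j) (iterBlockOf j b₀.src) - rep (Mk (⟨d + 1, L, m, K, hd, hL⟩ : Params) j) y))) := by
    intro b₀ y
    refine (blockBound_DgradHp hc hj' Λ' w lam b₀ y).trans (le_of_eq ?_)
    rw [h1, hA₂]; push_cast; ring
  have hTs : ∀ (y' y : Site (⟨d + 1, L, m, K, hd, hL⟩ : Params) j),
      ∑ b₀ ∈ univ.filter (fun b₀ : PBond (⟨d + 1, L, m, K, hd, hL⟩ : Params) 0 => iterBlockOf j b₀.src = y), |LinearMap.adjoint (((((L : ℝ) ^ j) • (onE (LinearMap.funLeft ℝ ℝ (fun b : PBond (⟨d + 1, L, m, K, hd, hL⟩ : Params) 0 => (⟨b.src.shift mu, b.dir⟩ : PBond (⟨d + 1, L, m, K, hd, hL⟩ : Params) 0))) - LinearMap.id) : BondSpace (⟨d + 1, L, m, K, hd, hL⟩ : Params) →ₗ[ℝ] BondSpace (⟨d + 1, L, m, K, hd, hL⟩ : Params))) ∘ₗ ((tsV1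 hc Λ' w).grad ∘ₗ (tsV1 hc Λ' w).hP)) (EuclideanSpace.single b₀ (1 : ℝ)) y'| ≤
        A₂ * (n * ((d + 1 : ℕ) : ℝ)) * Real.exp (-(κH * torusSupNorm (Mk (⟨d + 1, L, m, K, hd, hL⟩ : Params) j) (rep (Mk (⟨d + 1, L, m, K, hd, hL⟩ : Params) j) y' - rep (Mk (⟨d + 1, L, m, K, hd, hL⟩ : Params) j) y))) := by
    intro y' y
    refine (blockBound_DgradHp_adjoint hc Λ' w hj' mu y' y).trans (le_of_eq ?_)
    rw [h1, hcast, hA₂]; ring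
  have hCb : ∀ (x y : Site (⟨d + 1, L, m, K, hd, hL⟩ : Params) j),
      ∑ x' ∈ univ.filter (fun x' : Site (⟨d + 1, L, m, K, hd, hL⟩ : Params) j => x' = y), |(tsV1 hc Λ' w).C (EuclideanSpace.single x' (1 : ℝ)) x| ≤
        E / n * Real.exp (-(δC * torusSupNorm (Mk (⟨d + 1, L, m, K, hd, hL⟩ : Params) j) (rep (Mk (⟨d + 1, L, m, K, hd, hL⟩ : Params) j) x - rep (Mk (⟨d + 1, L, m, K, hd, hL⟩ : Params) j) y))) := by
    intro x y
    refine (blockBound_C_of_entry hc Λ' w (E := E / n) (δ := δC) (by positivity) (fun x x' => ?_) x y).trans (le_of_eq ?_)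
    · have h := hCov m K ((L : ℝ) ^ j) hc j hj Λ' w hw x x'
      rwa [hθ] at h
    · rw [Nat.cast_one, mul_one]
  rw [DK1Dadj_eq hc hj Λ' hw]
  have h := blockBound_comp3 hρ hK (((((L : ℝ) ^ j) • (onE (LinearMap.funLeft ℝ ℝ (fun b : PBond (⟨d + 1, L, m, K, hd, hL⟩ : Params) 0 => (⟨b.src.shift lam, b.dir⟩ : PBond (⟨d + 1, L, m, K, hd, hL⟩ : Params) 0))) - LinearMap.id) : BondSpace (⟨d + 1, L, m, K, hd, hL⟩ : Params) →ₗ[ℝ] BondSpace (⟨d + 1, L, m, K, hd, hL⟩ : Params))) ∘ₗ ((tsV1 hc Λ' w).grad ∘ₗ (tsV1 hc Λ' w).hP)) (tsV1 hc Λ' w).C (LinearMap.adjoint (((((L : ℝ) ^ j) • (onE (LinearMap.funLeft ℝ ℝ (fun b : PBond (⟨d + 1, L, m, K, hd, hL⟩ : Params) 0 => (⟨b.src.shift mu, b.dir⟩ : PBond (⟨d + 1, L, m, K, hd, hL⟩ : Params) 0))) - LinearMap.id) : BondSpace (⟨d + 1, L, m, K, hd, hL⟩ : Params) →ₗ[ℝ]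 BondSpace (⟨d + 1, L, m, K, hd, hL⟩ : Params))) ∘ₗ ((tsV1 hc Λ' w).grad ∘ₗ (tsV1 hc Λ' w).hP))) (fun b₀ : PBond (⟨d + 1, L, m, K, hd, hL⟩ : Params) 0 => iterBlockOf j b₀.src) (fun y : Site (⟨d + 1, L, m, K, hd, hL⟩ : Params) j => y)
    hA₂0 (by positivity : 0 ≤ E / n) (by positivity : 0 ≤ A₂ * (n * ((d + 1 : ℕ) : ℝ))) hK₁0
    hδ₁0.le hδ₁H hδ₁C hδ₂0.le hδ₂₁ hδ₂H hT hCb hTs b₀ y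
  refine h.trans (le_of_eq ?_)
  rw [hC, hK₁, hK₂]
  field_simp

open Classical in
/-- **`∇_λH_jQ_j` HAS AN EXPONENTIALLY DECAYING BLOCK KERNEL, UNIFORMLY** (at `c = L^j`): `∇_λH_j` `(C_D(d+1), κ_H)` (file 8), `Q_j` `(e^{κ_H}, κ_H)`
(file 6); composed at rate `κ_H/2` (file 25b's `blockBound_comp2r`). [cite: Balaban1984PropagatorsII, (2.130)–(2.131) p.246] -/
theorem blockBound_DHjQv_scaling (d L : ℕ) (hd : 1 ≤ d + 1) (hL : Odd L ∧ 1 < L) :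
    ∃ δ : ℝ, 0 < δ ∧ ∃ C : ℝ, 0 ≤ C ∧ ∀ (m K : ℕ) (j : ℕ) (hc : ((L : ℝ) ^ j) ≠ 0)
      (_hj : j + 1 ≤ (⟨d + 1, L, m, K, hd, hL⟩ : Params).m + (⟨d + 1, L, m, K, hd, hL⟩ : Params).K)
      (Λ' : Finset (Site (⟨d + 1, L, m, K, hd, hL⟩ : Params) (j + 1))) (w : CIdx j Λ' → ℝ) (_hw : ∀ i, 0 < w i) (lam : Fin (d + 1))
      (b₀ : PBond (⟨d + 1, L, m, K, hd, hL⟩ : Params) 0) (y : Site (⟨d + 1, L, m, K, hd, hL⟩ : Params) j),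
      ∑ b₀' ∈ univ.filter (fun b₀' : PBond (⟨d + 1, L, m, K, hd, hL⟩ : Params) 0 => iterBlockOf j b₀'.src = y),
          |(((((L : ℝ) ^ j) • (onE (LinearMap.funLeft ℝ ℝ (fun b : PBond (⟨d + 1, L, m, K, hd, hL⟩ : Params) 0 => (⟨b.src.shift lam, b.dir⟩ : PBond (⟨d + 1, L, m, K, hd, hL⟩ : Params) 0))) - LinearMap.id) : BondSpace (⟨d + 1, L, m, K, hd, hL⟩ : Params) →ₗ[ℝ] BondSpace (⟨d + 1, L, m, K, hd, hL⟩ : Params))) ∘ₗ (tsV1 hc Λ' w).Hj ∘ₗ (tsV1 hc Λ' w).Qv) (EuclideanSpace.single b₀' (1 : ℝ)) b₀| ≤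
        C * Real.exp (-(δ * torusSupNorm (Mk (⟨d + 1, L, m, K, hd, hL⟩ : Params) j) (rep (Mk (⟨d + 1, L, m, K, hd, hL⟩ : Params) j) (iterBlockOf j b₀.src) - rep (Mk (⟨d + 1, L, m, K, hd, hL⟩ : Params) j) y))) := by
  set κH : ℝ := kappa163 (d + 1) / ((d : ℝ) + 1) with hκH
  have hκH0 : 0 < κH := div_pos (kappa163_pos _) (by positivity)
  set K₁ : ℝ := latticeConst (d + 1) (κH - κH / 2) with hK₁
  have hK₁0 : 0 ≤ K₁ := latticeConst_nonneg _ (by linarith)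
  have hL0 : 0 < L := by have := hL.2; omega
  haveI : NeZero L := ⟨by omega⟩
  have hLp : (0 : ℝ) < L := by exact_mod_cast hL0
  have hAD0 : 0 ≤ CdecD d := CdecD_nonneg (d := d)
  set C : ℝ := CdecD d * ((1 * (d + 1) : ℕ) : ℝ) * Real.exp κH * K₁ with hC
  have hC0 : 0 ≤ C := by positivity
  refine ⟨κH / 2, by positivity, C, hC0, ?_⟩
  intro m K j hc hj Λ' w hw lam b₀ y
  have hj' : j ≤ m + K := Nat.le_of_succ_le hj
  have hρ : IsPseudoDist (fun t t' : Site (⟨d + 1, L, m, K, hd, hL⟩ : Params) j => torusSupNorm (Mk (⟨d + 1, L, m, K, hd, hL⟩ : Params) j) (rep (Mk (⟨d + 1, L, m, K, hd, hL⟩ : Params) j) t - rep (Mk (⟨d + 1, L, m, K, hd, hL⟩ : Params) j) t')) := torusDist_isPseudoDist (Mk (⟨d + 1, L, m, K, hd, hL⟩ : Params) j)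
  have hK : SumBound (fun t t' : Site (⟨d + 1, L, m, K, hd, hL⟩ : Params) j => torusSupNorm (Mk (⟨d + 1, L, m, K, hd, hL⟩ : Params) j) (rep (Mk (⟨d + 1, L, m, K, hd, hL⟩ : Params) j) t - rep (Mk (⟨d + 1, L, m, K, hd, hL⟩ : Params) j) t')) (fun a => latticeConst (d + 1) a) := torusDist_sumBound (Mk (⟨d + 1, L, m, K, hd, hL⟩ : Params) j)
  have hf := blockBound_DHj hc hj Λ' hw lam
  have hg : ∀ (b : PBond (⟨d + 1, L, m, K, hd, hL⟩ : Params) j) (y' : Site (⟨d + 1, L, m, K, hd, hL⟩ : Params) j),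
      ∑ b₀ ∈ univ.filter (fun b₀ : PBond (⟨d + 1, L, m, K, hd, hL⟩ : Params) 0 => iterBlockOf j b₀.src = y'), |(tsV1 hc Λ' w).Qv (EuclideanSpace.single b₀ (1 : ℝ)) b| ≤
        Real.exp κH * Real.exp (-(κH * torusSupNorm (Mk (⟨d + 1, L, m, K, hd, hL⟩ : Params) j) (rep (Mk (⟨d + 1, L, m, K, hd, hL⟩ : Params) j) b.src - rep (Mk (⟨d + 1, L, m, K, hd, hL⟩ : Params) j) y'))) := fun b y' => blockBound_Qv hc hj' Λ' w hκH0.le b y'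
  rw [DHjQv_eq]
  have h := blockBound_comp2r hρ hK (((((L : ℝ) ^ j) • (onE (LinearMap.funLeft ℝ ℝ (fun b : PBond (⟨d + 1, L, m, K, hd, hL⟩ : Params) 0 => (⟨b.src.shift lam, b.dir⟩ : PBond (⟨d + 1, L, m, K, hd, hL⟩ : Params) 0))) - LinearMap.id) : BondSpace (⟨d + 1, L, m, K, hd, hL⟩ : Params) →ₗ[ℝ] BondSpace (⟨d + 1, L, m, K, hd, hL⟩ : Params))) ∘ₗ (tsV1 hc Λ' w).Hj) (tsV1 hc Λ' w).Qv (fun b₀ : PBond (⟨d + 1, L, m, K, hd, hL⟩ : Params) 0 => iterBlockOf j b₀.src) (fun b : PBond (⟨d + 1, L, m, K, hd, hL⟩ : Params) j => b.src) (fun b₀ : PBond (⟨d + 1, L, m, K, hd, hL⟩ : Params) 0 => iterBlockOf j b₀.src) (by positivity) (by positivity) hκH0 hf hg b₀ y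
  refine h.trans (le_of_eq ?_)
  rw [hC, hK₁]

open Classical in
/-- **`Q_j*(∇_λH_j)* = (∇_λH_jQ_j)*` HAS AN EXPONENTIALLY DECAYING BLOCK KERNEL, UNIFORMLY** (the column sums of `∇_λH_jQ_j`; at `c = L^j`): `Q_j*`
`(n^{−(d+1)}e^{κ_H}, κ_H)` (file 20), `(∇_λH_j)*` `(C_Dn^{d+1}(d+1), κ_H)` (file 13); the powers of `n` cancel. [cite: Balaban1984PropagatorsII, (2.130)–(2.131) p.246] -/
theorem blockBound_DHjQvadj_scaling (d L : ℕ) (hd : 1 ≤ d + 1) (hL : Odd L ∧ 1 < L) :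
    ∃ δ : ℝ, 0 < δ ∧ ∃ C : ℝ, 0 ≤ C ∧ ∀ (m K : ℕ) (j : ℕ) (hc : ((L : ℝ) ^ j) ≠ 0)
      (_hj : j + 1 ≤ (⟨d + 1, L, m, K, hd, hL⟩ : Params).m + (⟨d + 1, L, m, K, hd, hL⟩ : Params).K)
      (Λ' : Finset (Site (⟨d + 1, L, m, K, hd, hL⟩ : Params) (j + 1))) (w : CIdx j Λ' → ℝ) (_hw : ∀ i, 0 < w i) (lam : Fin (d + 1))
      (b₀ : PBond (⟨d + 1, L, m, K, hd, hL⟩ : Params) 0) (y : Site (⟨d + 1, L, m, K, hd, hL⟩ : Params) j),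
      ∑ b₀' ∈ univ.filter (fun b₀' : PBond (⟨d + 1, L, m, K, hd, hL⟩ : Params) 0 => iterBlockOf j b₀'.src = y),
          |(LinearMap.adjoint (tsV1 hc Λ' w).Qv ∘ₗ LinearMap.adjoint (((((L : ℝ) ^ j) • (onE (LinearMap.funLeft ℝ ℝ (fun b : PBond (⟨d + 1, L, m, K, hd, hL⟩ : Params) 0 => (⟨b.src.shift lam, b.dir⟩ : PBond (⟨d + 1, L, m, K, hd, hL⟩ : Params) 0))) - LinearMap.id) : BondSpace (⟨d + 1, L, m, K, hd, hL⟩ : Params) →ₗ[ℝ] BondSpace (⟨d + 1, L, m, K, hd, hL⟩ : Params))) ∘ₗ (tsV1 hc Λ' w).Hj)) (EuclideanSpace.single b₀' (1 : ℝ)) b₀| ≤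
        C * Real.exp (-(δ * torusSupNorm (Mk (⟨d + 1, L, m, K, hd, hL⟩ : Params) j) (rep (Mk (⟨d + 1, L, m, K, hd, hL⟩ : Params) j) (iterBlockOf j b₀.src) - rep (Mk (⟨d + 1, L, m, K, hd, hL⟩ : Params) j) y))) := by
  set κH : ℝ := kappa163 (d + 1) / ((d : ℝ) + 1) with hκH
  have hκH0 : 0 < κH := div_pos (kappa163_pos _) (by positivity)
  set K₁ : ℝ := latticeConst (d + 1) (κH - κH / 2) with hK₁
  have hK₁0 : 0 ≤ K₁ := latticeConst_nonneg _ (by linarith)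
  have hL0 : 0 < L := by have := hL.2; omega
  haveI : NeZero L := ⟨by omega⟩
  have hLp : (0 : ℝ) < L := by exact_mod_cast hL0
  have hAD0 : 0 ≤ CdecD d := CdecD_nonneg (d := d)
  set C : ℝ := Real.exp κH * (CdecD d * ((d + 1 : ℕ) : ℝ)) * K₁ with hC
  have hC0 : 0 ≤ C := by positivity
  refine ⟨κH / 2, by positivity, C, hC0, ?_⟩
  intro m K j hc hj Λ' w hw lam b₀ y
  have hj' : j ≤ m + K := Nat.le_of_succ_le hj
  set n : ℝ := ((L : ℝ) ^ j) ^ (d + 1) with hn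
  have hn0 : 0 < n := by positivity
  have hLj : (0 : ℝ) < (L : ℝ) ^ j := by positivity
  have hρ : IsPseudoDist (fun t t' : Site (⟨d + 1, L, m, K, hd, hL⟩ : Params) j => torusSupNorm (Mk (⟨d + 1, L, m, K, hd, hL⟩ : Params) j) (rep (Mk (⟨d + 1, L, m, K, hd, hL⟩ : Params) j) t - rep (Mk (⟨d + 1, L, m, K, hd, hL⟩ : Params) j) t')) := torusDist_isPseudoDist (Mk (⟨d + 1, L, m, K, hd, hL⟩ : Params) j)
  have hK : SumBound (fun t t' : Site (⟨d + 1, L, m, K, hd, hL⟩ : Params) j => torusSupNorm (Mk (⟨d + 1, L, m, K, hd, hL⟩ : Params) j) (rep (Mk (⟨d + 1, L, m, K, hd, hL⟩ : Params) j) t - rep (Mk (⟨d + 1, L, m, K, hd, hL⟩ : Params) j) t')) (fun a => latticeConst (d + 1) a) := torusDist_sumBound (Mk (⟨d + 1, L, m, K, hd, hL⟩ : Params) j)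
  have h1 : |(L : ℝ) ^ j| / (L : ℝ) ^ j = 1 := by rw [abs_of_pos hLj, div_self hc]
  have hcast : (((L ^ j) ^ (d + 1) * (d + 1) : ℕ) : ℝ) = n * ((d + 1 : ℕ) : ℝ) := by rw [hn]; push_cast; ring
  have hηN : ((⟨d + 1, L, m, K, hd, hL⟩ : Params)).eta j ^ (d + 1) = n⁻¹ := by
    rw [hn, Params.eta, ← inv_pow, ← inv_pow]
  have hf : ∀ (b₀ : PBond (⟨d + 1, L, m, K, hd, hL⟩ : Params) 0) (y' : Site (⟨d + 1, L, m, K, hd, hL⟩ : Params) j),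
      ∑ b ∈ univ.filter (fun b : PBond (⟨d + 1, L, m, K, hd, hL⟩ : Params) j => b.src = y'), |LinearMap.adjoint (tsV1 hc Λ' w).Qv (EuclideanSpace.single b (1 : ℝ)) b₀| ≤
        n⁻¹ * Real.exp κH * Real.exp (-(κH * torusSupNorm (Mk (⟨d + 1, L, m, K, hd, hL⟩ : Params) j) (rep (Mk (⟨d + 1, L, m, K, hd, hL⟩ : Params) j) (iterBlockOf j b₀.src) - rep (Mk (⟨d + 1, L, m, K, hd, hL⟩ : Params) j) y'))) := by
    intro b₀ y'
    have h := blockBound_Qv_adjoint hc hj' Λ' w hκH0.le b₀ y'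
    rwa [hηN] at h
  have hg : ∀ (b : PBond (⟨d + 1, L, m, K, hd, hL⟩ : Params) j) (y' : Site (⟨d + 1, L, m, K, hd, hL⟩ : Params) j),
      ∑ b₀ ∈ univ.filter (fun b₀ : PBond (⟨d + 1, L, m, K, hd, hL⟩ : Params) 0 => iterBlockOf j b₀.src = y'), |LinearMap.adjoint (((((L : ℝ) ^ j) • (onE (LinearMap.funLeft ℝ ℝ (fun b : PBond (⟨d + 1, L, m, K, hd, hL⟩ : Params) 0 => (⟨b.src.shift lam, b.dir⟩ : PBond (⟨d + 1, L, m, K, hd, hL⟩ : Params) 0))) - LinearMap.id) : BondSpace (⟨d + 1, L, m, K, hd, hL⟩ : Params) →ₗ[ℝ] BondSpace (⟨d + 1, L, m, K, hd, hL⟩ : Params))) ∘ₗ (tsV1 hc Λ' w).Hj) (EuclideanSpace.single b₀ (1 : ℝ)) b| ≤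
        CdecD d * (n * ((d + 1 : ℕ) : ℝ)) * Real.exp (-(κH * torusSupNorm (Mk (⟨d + 1, L, m, K, hd, hL⟩ : Params) j) (rep (Mk (⟨d + 1, L, m, K, hd, hL⟩ : Params) j) b.src - rep (Mk (⟨d + 1, L, m, K, hd, hL⟩ : Params) j) y'))) := by
    intro b y'
    refine (blockBound_DHj_adjoint hc Λ' hj hw lam b y').trans (le_of_eq ?_)
    rw [hcast]
  have h := blockBound_comp2r hρ hK (LinearMap.adjoint (tsV1 hc Λ' w).Qv) (LinearMap.adjoint (((((L : ℝ) ^ j) • (onE (LinearMap.funLeft ℝ ℝ (fun b : PBond (⟨d + 1, L, m, K, hd, hL⟩ : Params) 0 => (⟨b.src.shift lam, b.dir⟩ : PBond (⟨d + 1, L, m, K, hd, hL⟩ : Params) 0))) - LinearMap.id) : BondSpace (⟨d + 1, L, m, K, hd, hL⟩ : Params) →ₗ[ℝ] BondSpace (⟨d + 1, L, m, K, hd, hL⟩ : Params))) ∘ₗ (tsV1 hc Λ' w).Hj)) (fun b₀ : PBond (⟨d + 1, L, m, K, hd, hL⟩ : Params) 0 => iterBlockOf j b₀.src) (fun b : PBond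 (⟨d + 1, L, m, K, hd, hL⟩ : Params) j => b.src) (fun b₀ : PBond (⟨d + 1, L, m, K, hd, hL⟩ : Params) 0 => iterBlockOf j b₀.src) (by positivity) (by positivity) hκH0 hf hg b₀ y
  refine h.trans (le_of_eq ?_)
  rw [hC, hK₁]
  field_simp

open Classical in
/-- **`∇_λH_jC̃H_j*∇_μ* = (∇_λH_j)C̃^{(j)}_Λ(∇_μH_j)*` HAS AN EXPONENTIALLY DECAYING BLOCK KERNEL, UNIFORMLY** (at `c = L^j`, weights
`a₀n^{d+1} ≤ w ≤ a₁n^{d+1}`): `∇_λH_j` `(C_D(d+1), κ_H)` (file 8), `C̃^{(j)}_Λ` `(E/n^{d+1}, δ_C)` (file 8), `(∇_μH_j)*` `(C_Dn^{d+1}(d+1), κ_H)` (file 13);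
file 3's `blockBound_comp3`. [cite: Balaban1984PropagatorsII, Prop. 2.5 p.246] -/
theorem blockBound_DHjCtHjD_scaling (d L : ℕ) (hd : 1 ≤ d + 1) (hL : Odd L ∧ 1 < L) {a₀ a₁ : ℝ} (ha₀ : 0 < a₀) (ha₁ : a₀ ≤ a₁) :
    ∃ δ : ℝ, 0 < δ ∧ ∃ C : ℝ, 0 ≤ C ∧ ∀ (m K : ℕ) (j : ℕ) (hc : ((L : ℝ) ^ j) ≠ 0)
      (_hj : j + 1 ≤ (⟨d + 1, L, m, K, hd, hL⟩ : Params).m + (⟨d + 1, L, m, K, hd, hL⟩ : Params).K)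
      (Λ' : Finset (Site (⟨d + 1, L, m, K, hd, hL⟩ : Params) (j + 1))) (w : CIdx j Λ' → ℝ)
      (_hw0 : ∀ i, a₀ * ((L : ℝ) ^ j) ^ (d + 1) ≤ w i) (_hw1 : ∀ i, w i ≤ a₁ * ((L : ℝ) ^ j) ^ (d + 1)) (lam mu : Fin (d + 1))
      (b₀ : PBond (⟨d + 1, L, m, K, hd, hL⟩ : Params) 0) (y : Site (⟨d + 1, L, m, K, hd, hL⟩ : Params) j),
      ∑ b₀' ∈ univ.filter (fun b₀' : PBond (⟨d + 1, L, m, K, hd, hL⟩ : Params) 0 => iterBlockOf j b₀'.src = y),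
          |(((((L : ℝ) ^ j) • (onE (LinearMap.funLeft ℝ ℝ (fun b : PBond (⟨d + 1, L, m, K, hd, hL⟩ : Params) 0 => (⟨b.src.shift lam, b.dir⟩ : PBond (⟨d + 1, L, m, K, hd, hL⟩ : Params) 0))) - LinearMap.id) : BondSpace (⟨d + 1, L, m, K, hd, hL⟩ : Params) →ₗ[ℝ] BondSpace (⟨d + 1, L, m, K, hd, hL⟩ : Params))) ∘ₗ (tsV1 hc Λ' w).Hj ∘ₗ (tsV1 hc Λ' w).Ct ∘ₗ LinearMap.adjoint (tsV1 hc Λ' w).Hj ∘ₗ ((((L : ℝ) ^ j) • (onE (LinearMap.funLeft ℝ ℝ (fun b : PBond (⟨d + 1, L, m, K, hd, hL⟩ : Params) 0 => (⟨b.src.unshift mu, b.dir⟩ : PBond (⟨d + 1, L, m, K, hd, hL⟩ : Params) 0))) - LinearMap.id) : BondSpace (⟨d + 1, L, m, K, hd, hL⟩ : Params) →ₗ[ℝ] BondSpace (⟨d + 1, L, m, K, hd, hL⟩ : Params)))) (EuclideanSpace.single b₀' (1 : ℝ)) b₀| ≤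
        C * Real.exp (-(δ * torusSupNorm (Mk (⟨d + 1, L, m, K, hd, hL⟩ : Params) j) (rep (Mk (⟨d + 1, L, m, K, hd, hL⟩ : Params) j) (iterBlockOf j b₀.src) - rep (Mk (⟨d + 1, L, m, K, hd, hL⟩ : Params) j) y))) := by
  obtain ⟨δC, hδC, E, hE, hCt⟩ := blockBound_Ct_scaling d L hd hL ha₀ ha₁
  set κH : ℝ := kappa163 (d + 1) / ((d : ℝ) + 1) with hκH
  have hκH0 : 0 < κH := div_pos (kappa163_pos _) (by positivity)
  set δ₁ : ℝ := min (δC / 2) κH with hδ₁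
  set δ₂ : ℝ := min (δC / 2) (κH / 2) with hδ₂
  have hδ₁0 : 0 < δ₁ := lt_min (half_pos hδC) hκH0
  have hδ₂0 : 0 < δ₂ := lt_min (half_pos hδC) (half_pos hκH0)
  have hδ₁C : δ₁ < δC := lt_of_le_of_lt (min_le_left _ _) (half_lt_self hδC)
  have hδ₁H : δ₁ ≤ κH := min_le_right _ _
  have hδ₂₁ : δ₂ ≤ δ₁ := le_min (min_le_left _ _) ((min_le_right _ _).trans (half_le_self hκH0.le))
  have hδ₂H : δ₂ < κH := lt_of_le_of_lt (min_le_right _ _) (half_lt_self hκH0)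
  set K₁ : ℝ := latticeConst (d + 1) (δC - δ₁) with hK₁
  set K₂ : ℝ := latticeConst (d + 1) (κH - δ₂) with hK₂
  have hK₁0 : 0 ≤ K₁ := latticeConst_nonneg _ (by linarith)
  have hK₂0 : 0 ≤ K₂ := latticeConst_nonneg _ (by linarith)
  have hL0 : 0 < L := by have := hL.2; omega
  haveI : NeZero L := ⟨by omega⟩
  have hLp : (0 : ℝ) < L := by exact_mod_cast hL0
  have hAD0 : 0 ≤ CdecD d := CdecD_nonneg (d := d)
  set C : ℝ := CdecD d * ((1 * (d + 1) : ℕ) : ℝ) * (E * (CdecD d * ((d + 1 : ℕ) : ℝ)) * K₁) * K₂ with hC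
  have hC0 : 0 ≤ C := by positivity
  refine ⟨δ₂, hδ₂0, C, hC0, ?_⟩
  intro m K j hc hj Λ' w hw0 hw1 lam mu b₀ y
  have hw : ∀ i, 0 < w i := fun i => lt_of_lt_of_le (by positivity) (hw0 i)
  have hj' : j ≤ m + K := Nat.le_of_succ_le hj
  set n : ℝ := ((L : ℝ) ^ j) ^ (d + 1) with hn
  have hn0 : 0 < n := by positivity
  have hLj : (0 : ℝ) < (L : ℝ) ^ j := by positivity
  have hρ : IsPseudoDist (fun t t' : Site (⟨d + 1, L, m, K, hd, hL⟩ : Params) j => torusSupNorm (Mk (⟨d + 1, L, m, K, hd, hL⟩ : Params) j) (rep (Mk (⟨d + 1, L, m, K, hd, hL⟩ : Params) j) t - rep (Mk (⟨d + 1, L, m, K, hd, hL⟩ : Params) j) t')) := torusDist_isPseudoDist (Mk (⟨d + 1, L, m, K, hd, hL⟩ : Params) j)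
  have hK : SumBound (fun t t' : Site (⟨d + 1, L, m, K, hd, hL⟩ : Params) j => torusSupNorm (Mk (⟨d + 1, L, m, K, hd, hL⟩ : Params) j) (rep (Mk (⟨d + 1, L, m, K, hd, hL⟩ : Params) j) t - rep (Mk (⟨d + 1, L, m, K, hd, hL⟩ : Params) j) t')) (fun a => latticeConst (d + 1) a) := torusDist_sumBound (Mk (⟨d + 1, L, m, K, hd, hL⟩ : Params) j)
  have h1 : |(L : ℝ) ^ j| / (L : ℝ) ^ j = 1 := by rw [abs_of_pos hLj, div_self hc]
  have hcast : (((L ^ j) ^ (d + 1) * (d + 1) : ℕ) : ℝ) = n * ((d + 1 : ℕ) : ℝ) := by rw [hn]; push_cast; ring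
  have hT := blockBound_DHj hc hj Λ' hw lam
  have hTs : ∀ (b : PBond (⟨d + 1, L, m, K, hd, hL⟩ : Params) j) (y : Site (⟨d + 1, L, m, K, hd, hL⟩ : Params) j),
      ∑ b₀ ∈ univ.filter (fun b₀ : PBond (⟨d + 1, L, m, K, hd, hL⟩ : Params) 0 => iterBlockOf j b₀.src = y), |LinearMap.adjoint (((((L : ℝ) ^ j) • (onE (LinearMap.funLeft ℝ ℝ (fun b : PBond (⟨d + 1, L, m, K, hd, hL⟩ : Params) 0 => (⟨b.src.shift mu, b.dir⟩ : PBond (⟨d + 1, L, m, K, hd, hL⟩ : Params) 0))) - LinearMap.id) : BondSpace (⟨d + 1, L, m, K, hd, hL⟩ : Params) →ₗ[ℝ] BondSpace (⟨d + 1, L, m, K, hd, hL⟩ : Params))) ∘ₗ (tsV1 hc Λ' w).Hj) (EuclideanSpace.single b₀ (1 : ℝ)) b| ≤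
        CdecD d * (n * ((d + 1 : ℕ) : ℝ)) * Real.exp (-(κH * torusSupNorm (Mk (⟨d + 1, L, m, K, hd, hL⟩ : Params) j) (rep (Mk (⟨d + 1, L, m, K, hd, hL⟩ : Params) j) b.src - rep (Mk (⟨d + 1, L, m, K, hd, hL⟩ : Params) j) y))) := by
    intro b y
    refine (blockBound_DHj_adjoint hc Λ' hj hw mu b y).trans (le_of_eq ?_)
    rw [hcast]
  have hCb : ∀ (b : PBond (⟨d + 1, L, m, K, hd, hL⟩ : Params) j) (y : Site (⟨d + 1, L, m, K, hd, hL⟩ : Params) j),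
      ∑ b' ∈ univ.filter (fun b' : PBond (⟨d + 1, L, m, K, hd, hL⟩ : Params) j => b'.src = y), |(tsV1 hc Λ' w).Ct (EuclideanSpace.single b' (1 : ℝ)) b| ≤
        E / n * Real.exp (-(δC * torusSupNorm (Mk (⟨d + 1, L, m, K, hd, hL⟩ : Params) j) (rep (Mk (⟨d + 1, L, m, K, hd, hL⟩ : Params) j) b.src - rep (Mk (⟨d + 1, L, m, K, hd, hL⟩ : Params) j) y))) :=
    fun b y => hCt m K j hc hj Λ' w hw0 hw1 b y
  rw [DHjCtHjD_eq]
  have h := blockBound_comp3 hρ hK (((((L : ℝ) ^ j) • (onE (LinearMap.funLeft ℝ ℝ (fun b : PBond (⟨d + 1, L, m, K, hd, hL⟩ : Params) 0 => (⟨b.src.shift lam, b.dir⟩ : PBond (⟨d + 1, L, m, K, hd, hL⟩ : Params) 0))) - LinearMap.id) : BondSpace (⟨d + 1, L, m, K, hd, hL⟩ : Params) →ₗ[ℝ] BondSpace (⟨d + 1, L, m, K, hd, hL⟩ : Params))) ∘ₗ (tsV1 hc Λ' w).Hj) (tsV1 hc Λ' w).Ct (LinearMap.adjoint (((((L : ℝ)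 ^ j) • (onE (LinearMap.funLeft ℝ ℝ (fun b : PBond (⟨d + 1, L, m, K, hd, hL⟩ : Params) 0 => (⟨b.src.shift mu, b.dir⟩ : PBond (⟨d + 1, L, m, K, hd, hL⟩ : Params) 0))) - LinearMap.id) : BondSpace (⟨d + 1, L, m, K, hd, hL⟩ : Params) →ₗ[ℝ] BondSpace (⟨d + 1, L, m, K, hd, hL⟩ : Params))) ∘ₗ (tsV1 hc Λ' w).Hj)) (fun b₀ : PBond (⟨d + 1, L, m, K, hd, hL⟩ : Params) 0 => iterBlockOf j b₀.src) (fun b : PBond (⟨d + 1, L, m, K, hd, hL⟩ : Params) j => b.src)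
    (by positivity) (by positivity : 0 ≤ E / n) (by positivity : 0 ≤ CdecD d * (n * ((d + 1 : ℕ) : ℝ))) hK₁0
    hδ₁0.le hδ₁H hδ₁C hδ₂0.le hδ₂₁ hδ₂H hT hCb hTs b₀ y
  refine h.trans (le_of_eq ?_)
  rw [hC, hK₁, hK₂]
  field_simp

end Rows

/-! ## §2  The `ℓ²`-block bounds (Schur test on blocks, file 23; columns = rows of the adjoint, §0) -/

section L2

open Classical in
/-- **THE `ℓ²`-BLOCK BOUND OF `∇_λK₁∇_μ*`, UNIFORMLY** (rows §1; columns = rows of `∇_μK₁∇_λ*`). [cite: Balaban1984PropagatorsII, Prop. 2.5 p.246; Balaban1984PropagatorsI, (1.114) p.36] -/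
theorem l2blk_DK1Dadj_scaling (d L : ℕ) (hd : 1 ≤ d + 1) (hL : Odd L ∧ 1 < L) :
    ∃ δ : ℝ, 0 < δ ∧ ∃ C : ℝ, 0 ≤ C ∧ ∀ (m K : ℕ) (j : ℕ) (hc : ((L : ℝ) ^ j) ≠ 0)
      (_hj : j + 1 ≤ (⟨d + 1, L, m, K, hd, hL⟩ : Params).m + (⟨d + 1, L, m, K, hd, hL⟩ : Params).K)
      (Λ' : Finset (Site (⟨d + 1, L, m, K, hd, hL⟩ : Params) (j + 1))) (w : CIdx j Λ' → ℝ) (_hw : ∀ i, 0 < w i) (lam mu : Fin (d + 1))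
      (y y' : Site (⟨d + 1, L, m, K, hd, hL⟩ : Params) j) (v u : BondSpace (⟨d + 1, L, m, K, hd, hL⟩ : Params))
      (_hv : ∀ b : PBond (⟨d + 1, L, m, K, hd, hL⟩ : Params) 0, iterBlockOf j b.src ≠ y → v b = 0) (_hu : ∀ b : PBond (⟨d + 1, L, m, K, hd, hL⟩ : Params) 0, iterBlockOf j b.src ≠ y' → u b = 0),
      |⟪v, (((((L : ℝ) ^ j) • (onE (LinearMap.funLeft ℝ ℝ (fun b : PBond (⟨d + 1, L, m, K, hd, hL⟩ : Params) 0 => (⟨b.src.shift lam, b.dir⟩ : PBond (⟨d + 1, L, m, K, hd, hL⟩ : Params) 0))) - LinearMap.id) : BondSpace (⟨d + 1, L, m, K, hd, hL⟩ : Params) →ₗ[ℝ] BondSpace (⟨d + 1, L, m, K, hd, hL⟩ : Params))) ∘ₗ (tsV1 hc Λ' w).K1 ∘ₗ ((((L : ℝ) ^ j) • (onE (LinearMap.funLeft ℝ ℝ (fun b : PBond (⟨d + 1, L, m, K, hd, hL⟩ : Params) 0 => (⟨b.src.unshift mu, b.dir⟩ : PBond (⟨d + 1, L, m, K, hd, hL⟩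 : Params) 0))) - LinearMap.id) : BondSpace (⟨d + 1, L, m, K, hd, hL⟩ : Params) →ₗ[ℝ] BondSpace (⟨d + 1, L, m, K, hd, hL⟩ : Params)))) u⟫_ℝ| ≤ C * Real.exp (-(δ * torusSupNorm (Mk (⟨d + 1, L, m, K, hd, hL⟩ : Params) j) (rep (Mk (⟨d + 1, L, m, K, hd, hL⟩ : Params) j) y - rep (Mk (⟨d + 1, L, m, K, hd, hL⟩ : Params) j) y'))) * (‖v‖ * ‖u‖) := by
  obtain ⟨δ₁, hδ₁, C₁, hC₁, hrow⟩ := blockBound_DK1Dadj_scaling d L hd hL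
  obtain ⟨δ₂, hδ₂, C₂, hC₂, hcol⟩ := blockBound_DK1Dadj_scaling d L hd hL
  refine ⟨min δ₁ δ₂, lt_min hδ₁ hδ₂, C₁ + C₂, by positivity, ?_⟩
  intro m K j hc hj Λ' w hw lam mu y y' v u hv hu
  have hL0 : 0 < L := by have := hL.2; omega
  haveI : NeZero L := ⟨by omega⟩
  have hLp : (0 : ℝ) < L := by exact_mod_cast hL0
  have hρ : IsPseudoDist (fun t t' : Site (⟨d + 1, L, m, K, hd, hL⟩ : Params) j => torusSupNorm (Mk (⟨d + 1, L, m, K, hd, hL⟩ : Params) j) (rep (Mk (⟨d + 1, L, m, K, hd, hL⟩ : Params) j) t - rep (Mk (⟨d + 1, L, m, K, hd, hL⟩ : Params) j) t')) := torusDist_isPseudoDist (Mk (⟨d + 1, L, m, K, hd, hL⟩ : Params) j)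
  have hf := blockBound_mono hρ (((((L : ℝ) ^ j) • (onE (LinearMap.funLeft ℝ ℝ (fun b : PBond (⟨d + 1, L, m, K, hd, hL⟩ : Params) 0 => (⟨b.src.shift lam, b.dir⟩ : PBond (⟨d + 1, L, m, K, hd, hL⟩ : Params) 0))) - LinearMap.id) : BondSpace (⟨d + 1, L, m, K, hd, hL⟩ : Params) →ₗ[ℝ] BondSpace (⟨d + 1, L, m, K, hd, hL⟩ : Params))) ∘ₗ (tsV1 hc Λ' w).K1 ∘ₗ ((((L : ℝ) ^ j) • (onE (LinearMap.funLeft ℝ ℝ (fun b : PBond (⟨d + 1, L, m, K, hd, hL⟩ : Params) 0 => (⟨b.src.unshift mu, b.dir⟩ : PBond (⟨d + 1, L, m, K, hd, hL⟩ : Params) 0))) - LinearMap.id) : BondSpace (⟨d + 1, L, m, K, hd, hL⟩ : Params) →ₗ[ℝ] BondSpace (⟨d + 1, L, m, K, hd, hL⟩ : Params)))) (fun b₀ : PBond (⟨d + 1, L, m, K, hd, hL⟩ : Params) 0 => iterBlockOf j b₀.src) (fun b₀ : PBond (⟨d + 1, L, m, K, hd, hL⟩ : Params) 0 => iterBlockOf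 j b₀.src) hC₁ le_rfl (min_le_left δ₁ δ₂) (hrow m K j hc hj Λ' w hw lam mu)
  have hg' : ∀ (b₀ : PBond (⟨d + 1, L, m, K, hd, hL⟩ : Params) 0) (y : Site (⟨d + 1, L, m, K, hd, hL⟩ : Params) j),
      ∑ b₀' ∈ univ.filter (fun b₀' : PBond (⟨d + 1, L, m, K, hd, hL⟩ : Params) 0 => iterBlockOf j b₀'.src = y),
          |LinearMap.adjoint (((((L : ℝ) ^ j) • (onE (LinearMap.funLeft ℝ ℝ (fun b : PBond (⟨d + 1, L, m, K, hd, hL⟩ : Params) 0 => (⟨b.src.shift lam, b.dir⟩ : PBond (⟨d + 1, L, m, K, hd, hL⟩ : Params) 0))) - LinearMap.id) : BondSpace (⟨d + 1, L, m, K, hd, hL⟩ : Params) →ₗ[ℝ] BondSpace (⟨d + 1, L, m, K, hd, hL⟩ : Params))) ∘ₗ (tsV1 hc Λ' w).K1 ∘ₗ ((((L : ℝ) ^ j) • (onE (LinearMap.funLeft ℝ ℝ (fun b : PBond (⟨d + 1, L, m, K, hd, hL⟩ : Params) 0 => (⟨b.src.unshift mu, b.dir⟩ : PBond (⟨d + 1,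 L, m, K, hd, hL⟩ : Params) 0))) - LinearMap.id) : BondSpace (⟨d + 1, L, m, K, hd, hL⟩ : Params) →ₗ[ℝ] BondSpace (⟨d + 1, L, m, K, hd, hL⟩ : Params)))) (EuclideanSpace.single b₀' (1 : ℝ)) b₀| ≤ C₂ * Real.exp (-(δ₂ * torusSupNorm (Mk (⟨d + 1, L, m, K, hd, hL⟩ : Params) j) (rep (Mk (⟨d + 1, L, m, K, hd, hL⟩ : Params) j) (iterBlockOf j b₀.src) - rep (Mk (⟨d + 1, L, m, K, hd, hL⟩ : Params) j) y))) := by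
    rw [adjoint_DK1Dadj_eq hc hj Λ' hw]
    exact hcol m K j hc hj Λ' w hw mu lam
  have hg := blockBound_mono hρ (LinearMap.adjoint (((((L : ℝ) ^ j) • (onE (LinearMap.funLeft ℝ ℝ (fun b : PBond (⟨d + 1, L, m, K, hd, hL⟩ : Params) 0 => (⟨b.src.shift lam, b.dir⟩ : PBond (⟨d + 1, L, m, K, hd, hL⟩ : Params) 0))) - LinearMap.id) : BondSpace (⟨d + 1, L, m, K, hd, hL⟩ : Params) →ₗ[ℝ] BondSpace (⟨d + 1, L, m, K, hd, hL⟩ : Params))) ∘ₗ (tsV1 hc Λ' w).K1 ∘ₗ ((((L : ℝ) ^ j) • (onE (LinearMap.funLeft ℝ ℝ (fun b : PBond (⟨d + 1, L, m, K, hd, hL⟩ : Params) 0 => (⟨b.src.unshift mu, b.dir⟩ : PBond (⟨d + 1, L, m, K, hd, hL⟩ : Params) 0))) - LinearMap.id) : BondSpace (⟨d + 1, L, m, K, hd, hL⟩ : Params) →ₗ[ℝ] BondSpace (⟨d + 1, L, m, K, hd, hL⟩ : Params))))) (fun b₀ : PBond (⟨d + 1, L, m, K, hd, hL⟩ : Params)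 0 => iterBlockOf j b₀.src) (fun b₀ : PBond (⟨d + 1, L, m, K, hd, hL⟩ : Params) 0 => iterBlockOf j b₀.src) hC₂ le_rfl (min_le_right δ₁ δ₂) hg'
  exact l2blk_of_blockBounds hρ (((((L : ℝ) ^ j) • (onE (LinearMap.funLeft ℝ ℝ (fun b : PBond (⟨d + 1, L, m, K, hd, hL⟩ : Params) 0 => (⟨b.src.shift lam, b.dir⟩ : PBond (⟨d + 1, L, m, K, hd, hL⟩ : Params) 0))) - LinearMap.id) : BondSpace (⟨d + 1, L, m, K, hd, hL⟩ : Params) →ₗ[ℝ] BondSpace (⟨d + 1, L, m, K, hd, hL⟩ : Params))) ∘ₗ (tsV1 hc Λ' w).K1 ∘ₗ ((((L : ℝ) ^ j) • (onE (LinearMap.funLeft ℝ ℝ (fun b : PBond (⟨d + 1, L, m, K, hd, hL⟩ : Params) 0 => (⟨b.src.unshift mu, b.dir⟩ : PBond (⟨d + 1, L, m, K, hd, hL⟩ : Params) 0))) - LinearMap.id) : BondSpace (⟨d + 1, L, m, K, hd, hL⟩ : Params) →ₗ[ℝ] BondSpace (⟨d + 1, L, m, K, hd, hL⟩ : Params))))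 (fun b₀ : PBond (⟨d + 1, L, m, K, hd, hL⟩ : Params) 0 => iterBlockOf j b₀.src) (fun b₀ : PBond (⟨d + 1, L, m, K, hd, hL⟩ : Params) 0 => iterBlockOf j b₀.src) hC₁ hC₂ (by positivity) (by nlinarith) hf hg y y' v u hv hu

open Classical in
/-- **THE `ℓ²`-BLOCK BOUND OF `∇_λH_jQ_j`, UNIFORMLY** (rows and columns §1). [cite: Balaban1984PropagatorsII, Prop. 2.5 p.246, (2.130)–(2.131)] -/
theorem l2blk_DHjQv_scaling (d L : ℕ) (hd : 1 ≤ d + 1) (hL : Odd L ∧ 1 < L) :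
    ∃ δ : ℝ, 0 < δ ∧ ∃ C : ℝ, 0 ≤ C ∧ ∀ (m K : ℕ) (j : ℕ) (hc : ((L : ℝ) ^ j) ≠ 0)
      (_hj : j + 1 ≤ (⟨d + 1, L, m, K, hd, hL⟩ : Params).m + (⟨d + 1, L, m, K, hd, hL⟩ : Params).K)
      (Λ' : Finset (Site (⟨d + 1, L, m, K, hd, hL⟩ : Params) (j + 1))) (w : CIdx j Λ' → ℝ) (_hw : ∀ i, 0 < w i) (lam : Fin (d + 1))
      (y y' : Site (⟨d + 1, L, m, K, hd, hL⟩ : Params) j) (v u : BondSpace (⟨d + 1, L, m, K, hd, hL⟩ : Params))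
      (_hv : ∀ b : PBond (⟨d + 1, L, m, K, hd, hL⟩ : Params) 0, iterBlockOf j b.src ≠ y → v b = 0) (_hu : ∀ b : PBond (⟨d + 1, L, m, K, hd, hL⟩ : Params) 0, iterBlockOf j b.src ≠ y' → u b = 0),
      |⟪v, (((((L : ℝ) ^ j) • (onE (LinearMap.funLeft ℝ ℝ (fun b : PBond (⟨d + 1, L, m, K, hd, hL⟩ : Params) 0 => (⟨b.src.shift lam, b.dir⟩ : PBond (⟨d + 1, L, m, K, hd, hL⟩ : Params) 0))) - LinearMap.id) : BondSpace (⟨d + 1, L, m, K, hd, hL⟩ : Params) →ₗ[ℝ] BondSpace (⟨d + 1, L, m, K, hd, hL⟩ : Params))) ∘ₗ (tsV1 hc Λ' w).Hj ∘ₗ (tsV1 hc Λ' w).Qv) u⟫_ℝ| ≤ C * Real.exp (-(δ * torusSupNorm (Mk (⟨d + 1, L, m, K, hd, hL⟩ : Params) j) (rep (Mk (⟨d + 1, L, m, K, hd, hL⟩ : Params) j) y - rep (Mk (⟨d + 1, L, m, K, hd, hL⟩ : Params) j) y'))) * (‖v‖ * ‖u‖) := by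
  obtain ⟨δ₁, hδ₁, C₁, hC₁, hrow⟩ := blockBound_DHjQv_scaling d L hd hL
  obtain ⟨δ₂, hδ₂, C₂, hC₂, hcol⟩ := blockBound_DHjQvadj_scaling d L hd hL
  refine ⟨min δ₁ δ₂, lt_min hδ₁ hδ₂, C₁ + C₂, by positivity, ?_⟩
  intro m K j hc hj Λ' w hw lam y y' v u hv hu
  have hρ : IsPseudoDist (fun t t' : Site (⟨d + 1, L, m, K, hd, hL⟩ : Params) j => torusSupNorm (Mk (⟨d + 1, L, m, K, hd, hL⟩ : Params) j) (rep (Mk (⟨d + 1, L, m, K, hd, hL⟩ : Params) j) t - rep (Mk (⟨d + 1, L, m, K, hd, hL⟩ : Params) j) t')) := torusDist_isPseudoDist (Mk (⟨d + 1, L, m, K, hd, hL⟩ : Params) j)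
  have hf := blockBound_mono hρ (((((L : ℝ) ^ j) • (onE (LinearMap.funLeft ℝ ℝ (fun b : PBond (⟨d + 1, L, m, K, hd, hL⟩ : Params) 0 => (⟨b.src.shift lam, b.dir⟩ : PBond (⟨d + 1, L, m, K, hd, hL⟩ : Params) 0))) - LinearMap.id) : BondSpace (⟨d + 1, L, m, K, hd, hL⟩ : Params) →ₗ[ℝ] BondSpace (⟨d + 1, L, m, K, hd, hL⟩ : Params))) ∘ₗ (tsV1 hc Λ' w).Hj ∘ₗ (tsV1 hc Λ' w).Qv) (fun b₀ : PBond (⟨d + 1, L, m, K, hd, hL⟩ : Params) 0 => iterBlockOf j b₀.src) (fun b₀ : PBond (⟨d + 1, L, m, K, hd, hL⟩ : Params) 0 => iterBlockOf j b₀.src) hC₁ le_rfl (min_le_left δ₁ δ₂) (hrow m K j hc hj Λ' w hw lam)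
  have hg' : ∀ (b₀ : PBond (⟨d + 1, L, m, K, hd, hL⟩ : Params) 0) (y : Site (⟨d + 1, L, m, K, hd, hL⟩ : Params) j),
      ∑ b₀' ∈ univ.filter (fun b₀' : PBond (⟨d + 1, L, m, K, hd, hL⟩ : Params) 0 => iterBlockOf j b₀'.src = y),
          |LinearMap.adjoint (((((L : ℝ) ^ j) • (onE (LinearMap.funLeft ℝ ℝ (fun b : PBond (⟨d + 1, L, m, K, hd, hL⟩ : Params) 0 => (⟨b.src.shift lam, b.dir⟩ : PBond (⟨d + 1, L, m, K, hd, hL⟩ : Params) 0))) - LinearMap.id) : BondSpace (⟨d + 1, L, m, K, hd, hL⟩ : Params) →ₗ[ℝ] BondSpace (⟨d + 1, L, m, K, hd, hL⟩ : Params))) ∘ₗ (tsV1 hc Λ' w).Hj ∘ₗ (tsV1 hc Λ' w).Qv) (EuclideanSpace.single b₀' (1 : ℝ)) b₀| ≤ C₂ * Real.exp (-(δ₂ * torusSupNorm (Mk (⟨d + 1, L, m, K, hd, hL⟩ : Params) j) (rep (Mk (⟨d + 1, L, m, K, hd, hL⟩ : Params) j) (iterBlockOf j b₀.src) - rep (Mk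 (⟨d + 1, L, m, K, hd, hL⟩ : Params) j) y))) := by
    rw [adjoint_DHjQv_eq]
    exact hcol m K j hc hj Λ' w hw lam
  have hg := blockBound_mono hρ (LinearMap.adjoint (((((L : ℝ) ^ j) • (onE (LinearMap.funLeft ℝ ℝ (fun b : PBond (⟨d + 1, L, m, K, hd, hL⟩ : Params) 0 => (⟨b.src.shift lam, b.dir⟩ : PBond (⟨d + 1, L, m, K, hd, hL⟩ : Params) 0))) - LinearMap.id) : BondSpace (⟨d + 1, L, m, K, hd, hL⟩ : Params) →ₗ[ℝ] BondSpace (⟨d + 1, L, m, K, hd, hL⟩ : Params))) ∘ₗ (tsV1 hc Λ' w).Hj ∘ₗ (tsV1 hc Λ' w).Qv)) (fun b₀ : PBond (⟨d + 1, L, m, K, hd, hL⟩ : Params) 0 => iterBlockOf j b₀.src) (fun b₀ : PBond (⟨d + 1, L, m, K, hd, hL⟩ : Params) 0 => iterBlockOf j b₀.src) hC₂ le_rfl (min_le_right δ₁ δ₂) hg'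
  exact l2blk_of_blockBounds hρ (((((L : ℝ) ^ j) • (onE (LinearMap.funLeft ℝ ℝ (fun b : PBond (⟨d + 1, L, m, K, hd, hL⟩ : Params) 0 => (⟨b.src.shift lam, b.dir⟩ : PBond (⟨d + 1, L, m, K, hd, hL⟩ : Params) 0))) - LinearMap.id) : BondSpace (⟨d + 1, L, m, K, hd, hL⟩ : Params) →ₗ[ℝ] BondSpace (⟨d + 1, L, m, K, hd, hL⟩ : Params))) ∘ₗ (tsV1 hc Λ' w).Hj ∘ₗ (tsV1 hc Λ' w).Qv) (fun b₀ : PBond (⟨d + 1, L, m, K, hd, hL⟩ : Params) 0 => iterBlockOf j b₀.src) (fun b₀ : PBond (⟨d + 1, L, m, K, hd, hL⟩ : Params) 0 => iterBlockOf j b₀.src) hC₁ hC₂ (by positivity) (by nlinarith) hf hg y y' v u hv hu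

open Classical in
/-- **THE `ℓ²`-BLOCK BOUND OF `∇_λH_jC̃H_j*∇_μ*`, UNIFORMLY** (weights `a₀n^{d+1} ≤ w ≤ a₁n^{d+1}`; rows §1; columns = rows of `∇_μH_jC̃H_j*∇_λ*`). [cite: Balaban1984PropagatorsII, Prop. 2.5 p.246; Balaban1984PropagatorsI, (1.114) p.36] -/
theorem l2blk_DHjCtHjD_scaling (d L : ℕ) (hd : 1 ≤ d + 1) (hL : Odd L ∧ 1 < L) {a₀ a₁ : ℝ} (ha₀ : 0 < a₀) (ha₁ : a₀ ≤ a₁) :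
    ∃ δ : ℝ, 0 < δ ∧ ∃ C : ℝ, 0 ≤ C ∧ ∀ (m K : ℕ) (j : ℕ) (hc : ((L : ℝ) ^ j) ≠ 0)
      (_hj : j + 1 ≤ (⟨d + 1, L, m, K, hd, hL⟩ : Params).m + (⟨d + 1, L, m, K, hd, hL⟩ : Params).K)
      (Λ' : Finset (Site (⟨d + 1, L, m, K, hd, hL⟩ : Params) (j + 1))) (w : CIdx j Λ' → ℝ) (_hw0 : ∀ i, a₀ * ((L : ℝ) ^ j) ^ (d + 1) ≤ w i) (_hw1 : ∀ i, w i ≤ a₁ * ((L : ℝ) ^ j) ^ (d + 1)) (lam mu : Fin (d + 1))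
      (y y' : Site (⟨d + 1, L, m, K, hd, hL⟩ : Params) j) (v u : BondSpace (⟨d + 1, L, m, K, hd, hL⟩ : Params))
      (_hv : ∀ b : PBond (⟨d + 1, L, m, K, hd, hL⟩ : Params) 0, iterBlockOf j b.src ≠ y → v b = 0) (_hu : ∀ b : PBond (⟨d + 1, L, m, K, hd, hL⟩ : Params) 0, iterBlockOf j b.src ≠ y' → u b = 0),
      |⟪v, (((((L : ℝ) ^ j) • (onE (LinearMap.funLeft ℝ ℝ (fun b : PBond (⟨d + 1, L, m, K, hd, hL⟩ : Params) 0 => (⟨b.src.shift lam, b.dir⟩ : PBond (⟨d + 1, L, m, K, hd, hL⟩ : Params) 0))) - LinearMap.id) : BondSpace (⟨d + 1, L, m, K, hd, hL⟩ : Params) →ₗ[ℝ] BondSpace (⟨d + 1, L, m, K, hd, hL⟩ : Params))) ∘ₗ (tsV1 hc Λ' w).Hj ∘ₗ (tsV1 hc Λ' w).Ct ∘ₗ LinearMap.adjoint (tsV1 hc Λ' w).Hj ∘ₗ ((((L : ℝ) ^ j) • (onE (LinearMap.funLeft ℝ ℝ (fun b : PBond (⟨d + 1, L, m, K, hd, hL⟩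 : Params) 0 => (⟨b.src.unshift mu, b.dir⟩ : PBond (⟨d + 1, L, m, K, hd, hL⟩ : Params) 0))) - LinearMap.id) : BondSpace (⟨d + 1, L, m, K, hd, hL⟩ : Params) →ₗ[ℝ] BondSpace (⟨d + 1, L, m, K, hd, hL⟩ : Params)))) u⟫_ℝ| ≤ C * Real.exp (-(δ * torusSupNorm (Mk (⟨d + 1, L, m, K, hd, hL⟩ : Params) j) (rep (Mk (⟨d + 1, L, m, K, hd, hL⟩ : Params) j) y - rep (Mk (⟨d + 1, L, m, K, hd, hL⟩ : Params) j) y'))) * (‖v‖ * ‖u‖) := by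
  obtain ⟨δ₁, hδ₁, C₁, hC₁, hrow⟩ := blockBound_DHjCtHjD_scaling d L hd hL ha₀ ha₁
  obtain ⟨δ₂, hδ₂, C₂, hC₂, hcol⟩ := blockBound_DHjCtHjD_scaling d L hd hL ha₀ ha₁
  refine ⟨min δ₁ δ₂, lt_min hδ₁ hδ₂, C₁ + C₂, by positivity, ?_⟩
  intro m K j hc hj Λ' w hw0 hw1 lam mu y y' v u hv hu
  have hL0 : 0 < L := by have := hL.2; omega
  haveI : NeZero L := ⟨by omega⟩
  have hLp : (0 : ℝ) < L := by exact_mod_cast hL0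
  have hw : ∀ i, 0 < w i := fun i => lt_of_lt_of_le (by positivity) (hw0 i)
  have hρ : IsPseudoDist (fun t t' : Site (⟨d + 1, L, m, K, hd, hL⟩ : Params) j => torusSupNorm (Mk (⟨d + 1, L, m, K, hd, hL⟩ : Params) j) (rep (Mk (⟨d + 1, L, m, K, hd, hL⟩ : Params) j) t - rep (Mk (⟨d + 1, L, m, K, hd, hL⟩ : Params) j) t')) := torusDist_isPseudoDist (Mk (⟨d + 1, L, m, K, hd, hL⟩ : Params) j)
  have hf := blockBound_mono hρ (((((L : ℝ) ^ j) • (onE (LinearMap.funLeft ℝ ℝ (fun b : PBond (⟨d + 1, L, m, K, hd, hL⟩ : Params) 0 => (⟨b.src.shift lam, b.dir⟩ : PBond (⟨d + 1, L, m, K, hd, hL⟩ : Params) 0))) - LinearMap.id) : BondSpace (⟨d + 1, L, m, K, hd, hL⟩ : Params) →ₗ[ℝ] BondSpace (⟨d + 1, L, m, K, hd, hL⟩ : Params))) ∘ₗ (tsV1 hc Λ' w).Hj ∘ₗ (tsV1 hc Λ' w).Ct ∘ₗ LinearMap.adjoint (tsV1 hc Λ' w).Hj ∘ₗ ((((L :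 ℝ) ^ j) • (onE (LinearMap.funLeft ℝ ℝ (fun b : PBond (⟨d + 1, L, m, K, hd, hL⟩ : Params) 0 => (⟨b.src.unshift mu, b.dir⟩ : PBond (⟨d + 1, L, m, K, hd, hL⟩ : Params) 0))) - LinearMap.id) : BondSpace (⟨d + 1, L, m, K, hd, hL⟩ : Params) →ₗ[ℝ] BondSpace (⟨d + 1, L, m, K, hd, hL⟩ : Params)))) (fun b₀ : PBond (⟨d + 1, L, m, K, hd, hL⟩ : Params) 0 => iterBlockOf j b₀.src) (fun b₀ : PBond (⟨d + 1, L, m, K, hd, hL⟩ : Params) 0 => iterBlockOf j b₀.src) hC₁ le_rfl (min_le_left δ₁ δ₂) (hrow m K j hc hj Λ' w hw0 hw1 lam mu)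
  have hg' : ∀ (b₀ : PBond (⟨d + 1, L, m, K, hd, hL⟩ : Params) 0) (y : Site (⟨d + 1, L, m, K, hd, hL⟩ : Params) j),
      ∑ b₀' ∈ univ.filter (fun b₀' : PBond (⟨d + 1, L, m, K, hd, hL⟩ : Params) 0 => iterBlockOf j b₀'.src = y),
          |LinearMap.adjoint (((((L : ℝ) ^ j) • (onE (LinearMap.funLeft ℝ ℝ (fun b : PBond (⟨d + 1, L, m, K, hd, hL⟩ : Params) 0 => (⟨b.src.shift lam, b.dir⟩ : PBond (⟨d + 1, L, m, K, hd, hL⟩ : Params) 0))) - LinearMap.id) : BondSpace (⟨d + 1, L, m, K, hd, hL⟩ : Params) →ₗ[ℝ] BondSpace (⟨d + 1, L, m, K, hd, hL⟩ : Params))) ∘ₗ (tsV1 hc Λ' w).Hj ∘ₗ (tsV1 hc Λ' w).Ct ∘ₗ LinearMap.adjoint (tsV1 hc Λ' w).Hj ∘ₗ ((((L : ℝ) ^ j) • (onE (LinearMap.funLeft ℝ ℝ (fun b : PBond (⟨d + 1, L, m, K, hd, hL⟩ : Params) 0 => (⟨b.src.unshift mu, b.dir⟩ : PBond (⟨d +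 1, L, m, K, hd, hL⟩ : Params) 0))) - LinearMap.id) : BondSpace (⟨d + 1, L, m, K, hd, hL⟩ : Params) →ₗ[ℝ] BondSpace (⟨d + 1, L, m, K, hd, hL⟩ : Params)))) (EuclideanSpace.single b₀' (1 : ℝ)) b₀| ≤ C₂ * Real.exp (-(δ₂ * torusSupNorm (Mk (⟨d + 1, L, m, K, hd, hL⟩ : Params) j) (rep (Mk (⟨d + 1, L, m, K, hd, hL⟩ : Params) j) (iterBlockOf j b₀.src) - rep (Mk (⟨d + 1, L, m, K, hd, hL⟩ : Params) j) y))) := by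
    rw [adjoint_DHjCtHjD_eq hc hj Λ' hw]
    exact hcol m K j hc hj Λ' w hw0 hw1 mu lam
  have hg := blockBound_mono hρ (LinearMap.adjoint (((((L : ℝ) ^ j) • (onE (LinearMap.funLeft ℝ ℝ (fun b : PBond (⟨d + 1, L, m, K, hd, hL⟩ : Params) 0 => (⟨b.src.shift lam, b.dir⟩ : PBond (⟨d + 1, L, m, K, hd, hL⟩ : Params) 0))) - LinearMap.id) : BondSpace (⟨d + 1, L, m, K, hd, hL⟩ : Params) →ₗ[ℝ] BondSpace (⟨d + 1, L, m, K, hd, hL⟩ : Params))) ∘ₗ (tsV1 hc Λ' w).Hj ∘ₗ (tsV1 hc Λ' w).Ct ∘ₗ LinearMap.adjoint (tsV1 hc Λ' w).Hj ∘ₗ ((((L : ℝ) ^ j) • (onE (LinearMap.funLeft ℝ ℝ (fun b : PBond (⟨d + 1, L, m, K, hd, hL⟩ : Params) 0 => (⟨b.src.unshift mu, b.dir⟩ : PBond (⟨d + 1, L, m, K, hd, hL⟩ : Params) 0))) - LinearMap.id) : BondSpace (⟨d + 1, L, m, K, hd, hL⟩ : Params) →ₗ[ℝ] BondSpace (⟨d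 + 1, L, m, K, hd, hL⟩ : Params))))) (fun b₀ : PBond (⟨d + 1, L, m, K, hd, hL⟩ : Params) 0 => iterBlockOf j b₀.src) (fun b₀ : PBond (⟨d + 1, L, m, K, hd, hL⟩ : Params) 0 => iterBlockOf j b₀.src) hC₂ le_rfl (min_le_right δ₁ δ₂) hg'
  exact l2blk_of_blockBounds hρ (((((L : ℝ) ^ j) • (onE (LinearMap.funLeft ℝ ℝ (fun b : PBond (⟨d + 1, L, m, K, hd, hL⟩ : Params) 0 => (⟨b.src.shift lam, b.dir⟩ : PBond (⟨d + 1, L, m, K, hd, hL⟩ : Params) 0))) - LinearMap.id) : BondSpace (⟨d + 1, L, m, K, hd, hL⟩ : Params) →ₗ[ℝ] BondSpace (⟨d + 1, L, m, K, hd, hL⟩ : Params))) ∘ₗ (tsV1 hc Λ' w).Hj ∘ₗ (tsV1 hc Λ' w).Ct ∘ₗ LinearMap.adjoint (tsV1 hc Λ' w).Hj ∘ₗ ((((L : ℝ) ^ j) • (onE (LinearMap.funLeft ℝ ℝ (fun b : PBond (⟨d + 1, L, m, K, hd, hL⟩ : Params) 0 => (⟨b.src.unshift mu, b.dir⟩ :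 PBond (⟨d + 1, L, m, K, hd, hL⟩ : Params) 0))) - LinearMap.id) : BondSpace (⟨d + 1, L, m, K, hd, hL⟩ : Params) →ₗ[ℝ] BondSpace (⟨d + 1, L, m, K, hd, hL⟩ : Params)))) (fun b₀ : PBond (⟨d + 1, L, m, K, hd, hL⟩ : Params) 0 => iterBlockOf j b₀.src) (fun b₀ : PBond (⟨d + 1, L, m, K, hd, hL⟩ : Params) 0 => iterBlockOf j b₀.src) hC₁ hC₂ (by positivity) (by nlinarith) hf hg y y' v u hv hu

open Classical in
/-- **THE `ℓ²`-BLOCK BOUND OF `∇_λK₂*`, UNIFORMLY** (rows file 9; columns = rows of `K₂∇_λ*`, file 13). [cite: Balaban1984PropagatorsII, Prop. 2.5 p.246; Balaban1984PropagatorsI, (1.114) p.36] -/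
theorem l2blk_DK2adj_scaling (d L : ℕ) (hd : 1 ≤ d + 1) (hL : Odd L ∧ 1 < L) :
    ∃ δ : ℝ, 0 < δ ∧ ∃ C : ℝ, 0 ≤ C ∧ ∀ (m K : ℕ) (j : ℕ) (hc : ((L : ℝ) ^ j) ≠ 0)
      (_hj : j + 1 ≤ (⟨d + 1, L, m, K, hd, hL⟩ : Params).m + (⟨d + 1, L, m, K, hd, hL⟩ : Params).K)
      (Λ' : Finset (Site (⟨d + 1, L, m, K, hd, hL⟩ : Params) (j + 1))) (w : CIdx j Λ' → ℝ) (_hw : ∀ i, 0 < w i) (lam : Fin (d + 1))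
      (y y' : Site (⟨d + 1, L, m, K, hd, hL⟩ : Params) j) (v u : BondSpace (⟨d + 1, L, m, K, hd, hL⟩ : Params))
      (_hv : ∀ b : PBond (⟨d + 1, L, m, K, hd, hL⟩ : Params) 0, iterBlockOf j b.src ≠ y → v b = 0) (_hu : ∀ b : PBond (⟨d + 1, L, m, K, hd, hL⟩ : Params) 0, iterBlockOf j b.src ≠ y' → u b = 0),
      |⟪v, (((((L : ℝ) ^ j) • (onE (LinearMap.funLeft ℝ ℝ (fun b : PBond (⟨d + 1, L, m, K, hd, hL⟩ : Params) 0 => (⟨b.src.shift lam, b.dir⟩ : PBond (⟨d + 1, L, m, K, hd, hL⟩ : Params) 0))) - LinearMap.id) : BondSpace (⟨d + 1, L, m, K, hd, hL⟩ : Params) →ₗ[ℝ] BondSpace (⟨d + 1, L, m, K, hd, hL⟩ : Params))) ∘ₗ LinearMap.adjoint (tsV1 hc Λ' w).K2) u⟫_ℝ| ≤ C * Real.exp (-(δ * torusSupNorm (Mk (⟨d + 1, L, m, K, hd, hL⟩ : Params) j) (rep (Mk (⟨d + 1, L, m, K, hd, hL⟩ : Params) j) y - rep (Mk (⟨d + 1,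 L, m, K, hd, hL⟩ : Params) j) y'))) * (‖v‖ * ‖u‖) := by
  obtain ⟨δ₁, hδ₁, C₁, hC₁, hrow⟩ := blockBound_DK2adj_scaling d L hd hL
  obtain ⟨δ₂, hδ₂, C₂, hC₂, hcol⟩ := blockBound_K2Dadj_scaling d L hd hL
  refine ⟨min δ₁ δ₂, lt_min hδ₁ hδ₂, C₁ + C₂, by positivity, ?_⟩
  intro m K j hc hj Λ' w hw lam y y' v u hv hu
  have hρ : IsPseudoDist (fun t t' : Site (⟨d + 1, L, m, K, hd, hL⟩ : Params) j => torusSupNorm (Mk (⟨d + 1, L, m, K, hd, hL⟩ : Params) j) (rep (Mk (⟨d + 1, L, m, K, hd, hL⟩ : Params) j) t - rep (Mk (⟨d + 1, L, m, K, hd, hL⟩ : Params) j) t')) := torusDist_isPseudoDist (Mk (⟨d + 1, L, m, K, hd, hL⟩ : Params) j)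
  have hf := blockBound_mono hρ (((((L : ℝ) ^ j) • (onE (LinearMap.funLeft ℝ ℝ (fun b : PBond (⟨d + 1, L, m, K, hd, hL⟩ : Params) 0 => (⟨b.src.shift lam, b.dir⟩ : PBond (⟨d + 1, L, m, K, hd, hL⟩ : Params) 0))) - LinearMap.id) : BondSpace (⟨d + 1, L, m, K, hd, hL⟩ : Params) →ₗ[ℝ] BondSpace (⟨d + 1, L, m, K, hd, hL⟩ : Params))) ∘ₗ LinearMap.adjoint (tsV1 hc Λ' w).K2) (fun b₀ : PBond (⟨d + 1, L, m, K, hd, hL⟩ : Params) 0 => iterBlockOf j b₀.src) (fun b₀ : PBond (⟨d + 1, L, m, K, hd, hL⟩ : Params) 0 => iterBlockOf j b₀.src) hC₁ le_rfl (min_le_left δ₁ δ₂) (hrow m K j hc hj Λ' w hw lam)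
  have hg' : ∀ (b₀ : PBond (⟨d + 1, L, m, K, hd, hL⟩ : Params) 0) (y : Site (⟨d + 1, L, m, K, hd, hL⟩ : Params) j),
      ∑ b₀' ∈ univ.filter (fun b₀' : PBond (⟨d + 1, L, m, K, hd, hL⟩ : Params) 0 => iterBlockOf j b₀'.src = y),
          |LinearMap.adjoint (((((L : ℝ) ^ j) • (onE (LinearMap.funLeft ℝ ℝ (fun b : PBond (⟨d + 1, L, m, K, hd, hL⟩ : Params) 0 => (⟨b.src.shift lam, b.dir⟩ : PBond (⟨d + 1, L, m, K, hd, hL⟩ : Params) 0))) - LinearMap.id) : BondSpace (⟨d + 1, L, m, K, hd, hL⟩ : Params) →ₗ[ℝ] BondSpace (⟨d + 1, L, m, K, hd, hL⟩ : Params))) ∘ₗ LinearMap.adjoint (tsV1 hc Λ' w).K2) (EuclideanSpace.single b₀' (1 : ℝ)) b₀| ≤ C₂ * Real.exp (-(δ₂ * torusSupNorm (Mk (⟨d + 1, L, m, K, hd, hL⟩ : Params) j) (rep (Mk (⟨d + 1, L, m, K, hd, hL⟩ : Params) j) (iterBlockOf j b₀.src) - rep (Mk (⟨d + 1, L, m,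 K, hd, hL⟩ : Params) j) y))) := by
    rw [adjoint_DK2adj_eq]
    exact hcol m K j hc hj Λ' w hw lam
  have hg := blockBound_mono hρ (LinearMap.adjoint (((((L : ℝ) ^ j) • (onE (LinearMap.funLeft ℝ ℝ (fun b : PBond (⟨d + 1, L, m, K, hd, hL⟩ : Params) 0 => (⟨b.src.shift lam, b.dir⟩ : PBond (⟨d + 1, L, m, K, hd, hL⟩ : Params) 0))) - LinearMap.id) : BondSpace (⟨d + 1, L, m, K, hd, hL⟩ : Params) →ₗ[ℝ] BondSpace (⟨d + 1, L, m, K, hd, hL⟩ : Params))) ∘ₗ LinearMap.adjoint (tsV1 hc Λ' w).K2)) (fun b₀ : PBond (⟨d + 1, L, m, K, hd, hL⟩ : Params) 0 => iterBlockOf j b₀.src) (fun b₀ : PBond (⟨d + 1, L, m, K, hd, hL⟩ : Params) 0 => iterBlockOf j b₀.src) hC₂ le_rfl (min_le_right δ₁ δ₂) hg'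
  exact l2blk_of_blockBounds hρ (((((L : ℝ) ^ j) • (onE (LinearMap.funLeft ℝ ℝ (fun b : PBond (⟨d + 1, L, m, K, hd, hL⟩ : Params) 0 => (⟨b.src.shift lam, b.dir⟩ : PBond (⟨d + 1, L, m, K, hd, hL⟩ : Params) 0))) - LinearMap.id) : BondSpace (⟨d + 1, L, m, K, hd, hL⟩ : Params) →ₗ[ℝ] BondSpace (⟨d + 1, L, m, K, hd, hL⟩ : Params))) ∘ₗ LinearMap.adjoint (tsV1 hc Λ' w).K2) (fun b₀ : PBond (⟨d + 1, L, m, K, hd, hL⟩ : Params) 0 => iterBlockOf j b₀.src) (fun b₀ : PBond (⟨d + 1, L, m, K, hd, hL⟩ : Params) 0 => iterBlockOf j b₀.src) hC₁ hC₂ (by positivity) (by nlinarith) hf hg y y' v u hv hu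

open Classical in
/-- **THE `ℓ²`-BLOCK BOUND OF `K₂∇_λ*`, UNIFORMLY** (rows file 13; columns = rows of `∇_λK₂*`, file 9). [cite: Balaban1984PropagatorsII, Prop. 2.5 p.246; Balaban1984PropagatorsI, (1.114) p.36] -/
theorem l2blk_K2Dadj_scaling (d L : ℕ) (hd : 1 ≤ d + 1) (hL : Odd L ∧ 1 < L) :
    ∃ δ : ℝ, 0 < δ ∧ ∃ C : ℝ, 0 ≤ C ∧ ∀ (m K : ℕ) (j : ℕ) (hc : ((L : ℝ) ^ j) ≠ 0)
      (_hj : j + 1 ≤ (⟨d + 1, L, m, K, hd, hL⟩ : Params).m + (⟨d + 1, L, m, K, hd, hL⟩ : Params).K)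
      (Λ' : Finset (Site (⟨d + 1, L, m, K, hd, hL⟩ : Params) (j + 1))) (w : CIdx j Λ' → ℝ) (_hw : ∀ i, 0 < w i) (lam : Fin (d + 1))
      (y y' : Site (⟨d + 1, L, m, K, hd, hL⟩ : Params) j) (v u : BondSpace (⟨d + 1, L, m, K, hd, hL⟩ : Params))
      (_hv : ∀ b : PBond (⟨d + 1, L, m, K, hd, hL⟩ : Params) 0, iterBlockOf j b.src ≠ y → v b = 0) (_hu : ∀ b : PBond (⟨d + 1, L, m, K, hd, hL⟩ : Params) 0, iterBlockOf j b.src ≠ y' → u b = 0),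
      |⟪v, ((tsV1 hc Λ' w).K2 ∘ₗ ((((L : ℝ) ^ j) • (onE (LinearMap.funLeft ℝ ℝ (fun b : PBond (⟨d + 1, L, m, K, hd, hL⟩ : Params) 0 => (⟨b.src.unshift lam, b.dir⟩ : PBond (⟨d + 1, L, m, K, hd, hL⟩ : Params) 0))) - LinearMap.id) : BondSpace (⟨d + 1, L, m, K, hd, hL⟩ : Params) →ₗ[ℝ] BondSpace (⟨d + 1, L, m, K, hd, hL⟩ : Params)))) u⟫_ℝ| ≤ C * Real.exp (-(δ * torusSupNorm (Mk (⟨d + 1, L, m, K, hd, hL⟩ : Params) j) (rep (Mk (⟨d + 1, L, m, K, hd, hL⟩ : Params) j) y - rep (Mk (⟨d + 1, L, m, K, hd, hL⟩ : Params) j) y'))) * (‖v‖ * ‖u‖) := by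
  obtain ⟨δ₁, hδ₁, C₁, hC₁, hrow⟩ := blockBound_K2Dadj_scaling d L hd hL
  obtain ⟨δ₂, hδ₂, C₂, hC₂, hcol⟩ := blockBound_DK2adj_scaling d L hd hL
  refine ⟨min δ₁ δ₂, lt_min hδ₁ hδ₂, C₁ + C₂, by positivity, ?_⟩
  intro m K j hc hj Λ' w hw lam y y' v u hv hu
  have hρ : IsPseudoDist (fun t t' : Site (⟨d + 1, L, m, K, hd, hL⟩ : Params) j => torusSupNorm (Mk (⟨d + 1, L, m, K, hd, hL⟩ : Params) j) (rep (Mk (⟨d + 1, L, m, K, hd, hL⟩ : Params) j) t - rep (Mk (⟨d + 1, L, m, K, hd, hL⟩ : Params) j) t')) := torusDist_isPseudoDist (Mk (⟨d + 1, L, m, K, hd, hL⟩ : Params) j)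
  have hf := blockBound_mono hρ ((tsV1 hc Λ' w).K2 ∘ₗ ((((L : ℝ) ^ j) • (onE (LinearMap.funLeft ℝ ℝ (fun b : PBond (⟨d + 1, L, m, K, hd, hL⟩ : Params) 0 => (⟨b.src.unshift lam, b.dir⟩ : PBond (⟨d + 1, L, m, K, hd, hL⟩ : Params) 0))) - LinearMap.id) : BondSpace (⟨d + 1, L, m, K, hd, hL⟩ : Params) →ₗ[ℝ] BondSpace (⟨d + 1, L, m, K, hd, hL⟩ : Params)))) (fun b₀ : PBond (⟨d + 1, L, m, K, hd, hL⟩ : Params) 0 => iterBlockOf j b₀.src) (fun b₀ : PBond (⟨d + 1, L, m, K, hd, hL⟩ : Params) 0 => iterBlockOf j b₀.src) hC₁ le_rfl (min_le_left δ₁ δ₂) (hrow m K j hc hj Λ' w hw lam)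
  have hg' : ∀ (b₀ : PBond (⟨d + 1, L, m, K, hd, hL⟩ : Params) 0) (y : Site (⟨d + 1, L, m, K, hd, hL⟩ : Params) j),
      ∑ b₀' ∈ univ.filter (fun b₀' : PBond (⟨d + 1, L, m, K, hd, hL⟩ : Params) 0 => iterBlockOf j b₀'.src = y),
          |LinearMap.adjoint ((tsV1 hc Λ' w).K2 ∘ₗ ((((L : ℝ) ^ j) • (onE (LinearMap.funLeft ℝ ℝ (fun b : PBond (⟨d + 1, L, m, K, hd, hL⟩ : Params) 0 => (⟨b.src.unshift lam, b.dir⟩ : PBond (⟨d + 1, L, m, K, hd, hL⟩ : Params) 0))) - LinearMap.id) : BondSpace (⟨d + 1, L, m, K, hd, hL⟩ : Params) →ₗ[ℝ] BondSpace (⟨d + 1, L, m, K, hd, hL⟩ : Params)))) (EuclideanSpace.single b₀' (1 : ℝ)) b₀| ≤ C₂ * Real.exp (-(δ₂ * torusSupNorm (Mk (⟨d + 1, L, m, K, hd, hL⟩ : Params) j) (rep (Mk (⟨d + 1, L, m, K, hd, hL⟩ : Params) j) (iterBlockOf j b₀.src) - rep (Mk (⟨d + 1, L, m, K, hd, hL⟩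 : Params) j) y))) := by
    rw [adjoint_K2Dadj_eq]
    exact hcol m K j hc hj Λ' w hw lam
  have hg := blockBound_mono hρ (LinearMap.adjoint ((tsV1 hc Λ' w).K2 ∘ₗ ((((L : ℝ) ^ j) • (onE (LinearMap.funLeft ℝ ℝ (fun b : PBond (⟨d + 1, L, m, K, hd, hL⟩ : Params) 0 => (⟨b.src.unshift lam, b.dir⟩ : PBond (⟨d + 1, L, m, K, hd, hL⟩ : Params) 0))) - LinearMap.id) : BondSpace (⟨d + 1, L, m, K, hd, hL⟩ : Params) →ₗ[ℝ] BondSpace (⟨d + 1, L, m, K, hd, hL⟩ : Params))))) (fun b₀ : PBond (⟨d + 1, L, m, K, hd, hL⟩ : Params) 0 => iterBlockOf j b₀.src) (fun b₀ : PBond (⟨d + 1, L, m, K, hd, hL⟩ : Params) 0 => iterBlockOf j b₀.src) hC₂ le_rfl (min_le_right δ₁ δ₂) hg'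
  exact l2blk_of_blockBounds hρ ((tsV1 hc Λ' w).K2 ∘ₗ ((((L : ℝ) ^ j) • (onE (LinearMap.funLeft ℝ ℝ (fun b : PBond (⟨d + 1, L, m, K, hd, hL⟩ : Params) 0 => (⟨b.src.unshift lam, b.dir⟩ : PBond (⟨d + 1, L, m, K, hd, hL⟩ : Params) 0))) - LinearMap.id) : BondSpace (⟨d + 1, L, m, K, hd, hL⟩ : Params) →ₗ[ℝ] BondSpace (⟨d + 1, L, m, K, hd, hL⟩ : Params)))) (fun b₀ : PBond (⟨d + 1, L, m, K, hd, hL⟩ : Params) 0 => iterBlockOf j b₀.src) (fun b₀ : PBond (⟨d + 1, L, m, K, hd, hL⟩ : Params) 0 => iterBlockOf j b₀.src) hC₁ hC₂ (by positivity) (by nlinarith) hf hg y y' v u hv hu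

open Classical in
/-- **THE `ℓ²`-BLOCK BOUND OF `∇_λG^{(w′)}`, UNIFORMLY** (`w′ = a·n^{d+1}`; rows: file 8's (1.110)₂ member; columns: file 12's (1.110)₃ member). [cite: Balaban1984PropagatorsI, Prop. 1.2 (1.110), (1.114) pp.35–36; Balaban1984PropagatorsII, p.246] -/
theorem l2blk_DGE_scaling (d L : ℕ) (hd : 1 ≤ d + 1) (hL : Odd L ∧ 1 < L) {a : ℝ} (ha : 0 < a) :
    ∃ δ : ℝ, 0 < δ ∧ ∃ C : ℝ, 0 ≤ C ∧ ∀ (m K j : ℕ)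
      (hj' : j ≤ (⟨d + 1, L, m, K, hd, hL⟩ : Params).m + (⟨d + 1, L, m, K, hd, hL⟩ : Params).K) (hc : ((L : ℝ) ^ j) ≠ 0)
      (hw' : (0 : ℝ) < a * ((L : ℝ) ^ j) ^ (d + 1)) (lam : Fin (d + 1))
      (y y' : Site (⟨d + 1, L, m, K, hd, hL⟩ : Params) j) (v u : BondSpace (⟨d + 1, L, m, K, hd, hL⟩ : Params))
      (_hv : ∀ b : PBond (⟨d + 1, L, m, K, hd, hL⟩ : Params) 0, iterBlockOf j b.src ≠ y → v b = 0) (_hu : ∀ b : PBond (⟨d + 1, L, m, K, hd, hL⟩ : Params) 0, iterBlockOf j b.src ≠ y' → u b = 0),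
      |⟪v, (((((L : ℝ) ^ j) • (onE (LinearMap.funLeft ℝ ℝ (fun b : PBond (⟨d + 1, L, m, K, hd, hL⟩ : Params) 0 => (⟨b.src.shift lam, b.dir⟩ : PBond (⟨d + 1, L, m, K, hd, hL⟩ : Params) 0))) - LinearMap.id) : BondSpace (⟨d + 1, L, m, K, hd, hL⟩ : Params) →ₗ[ℝ] BondSpace (⟨d + 1, L, m, K, hd, hL⟩ : Params))) ∘ₗ (GE (Domains.whole (P := (⟨d + 1, L, m, K, hd, hL⟩ : Params)) j hj') hc (w := fun _ => a * ((L : ℝ) ^ j) ^ (d + 1)) (fun _ => hw'))) u⟫_ℝ| ≤ C * Real.exp (-(δ * torusSupNorm (Mk (⟨d + 1, L, m, K, hd, hL⟩ : Params) j) (rep (Mk (⟨d + 1, L, m, K, hd, hL⟩ : Params) j) y - rep (Mk (⟨d + 1, L, m, K, hd, hL⟩ : Params) j) y'))) * (‖v‖ * ‖u‖) := by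
  obtain ⟨δ₁, hδ₁, C₁, hC₁, hrow⟩ := blockBound_DGE_scaling d L hd hL ha
  obtain ⟨δ₂, hδ₂, C₂, hC₂, hcol⟩ := blockBound_GEDadj_scaling d L hd hL ha
  refine ⟨min δ₁ δ₂, lt_min hδ₁ hδ₂, C₁ + C₂, by positivity, ?_⟩
  intro m K j hj' hc hw' lam y y' v u hv hu
  have hρ : IsPseudoDist (fun t t' : Site (⟨d + 1, L, m, K, hd, hL⟩ : Params) j => torusSupNorm (Mk (⟨d + 1, L, m, K, hd, hL⟩ : Params) j) (rep (Mk (⟨d + 1, L, m, K, hd, hL⟩ : Params) j) t - rep (Mk (⟨d + 1, L, m, K, hd, hL⟩ : Params) j) t')) := torusDist_isPseudoDist (Mk (⟨d + 1, L, m, K, hd, hL⟩ : Params) j)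
  have hf := blockBound_mono hρ (((((L : ℝ) ^ j) • (onE (LinearMap.funLeft ℝ ℝ (fun b : PBond (⟨d + 1, L, m, K, hd, hL⟩ : Params) 0 => (⟨b.src.shift lam, b.dir⟩ : PBond (⟨d + 1, L, m, K, hd, hL⟩ : Params) 0))) - LinearMap.id) : BondSpace (⟨d + 1, L, m, K, hd, hL⟩ : Params) →ₗ[ℝ] BondSpace (⟨d + 1, L, m, K, hd, hL⟩ : Params))) ∘ₗ (GE (Domains.whole (P := (⟨d + 1, L, m, K, hd, hL⟩ : Params)) j hj') hc (w := fun _ => a * ((L : ℝ) ^ j) ^ (d + 1)) (fun _ => hw'))) (fun b₀ : PBond (⟨d + 1, L, m, K, hd, hL⟩ : Params) 0 => iterBlockOf j b₀.src) (fun b₀ : PBond (⟨d + 1, L, m, K, hd, hL⟩ : Params) 0 => iterBlockOf j b₀.src) hC₁ le_rfl (min_le_left δ₁ δ₂) (hrow m K j hj' hc hw' lam)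
  have hg' : ∀ (b₀ : PBond (⟨d + 1, L, m, K, hd, hL⟩ : Params) 0) (y : Site (⟨d + 1, L, m, K, hd, hL⟩ : Params) j),
      ∑ b₀' ∈ univ.filter (fun b₀' : PBond (⟨d + 1, L, m, K, hd, hL⟩ : Params) 0 => iterBlockOf j b₀'.src = y),
          |LinearMap.adjoint (((((L : ℝ) ^ j) • (onE (LinearMap.funLeft ℝ ℝ (fun b : PBond (⟨d + 1, L, m, K, hd, hL⟩ : Params) 0 => (⟨b.src.shift lam, b.dir⟩ : PBond (⟨d + 1, L, m, K, hd, hL⟩ : Params) 0))) - LinearMap.id) : BondSpace (⟨d + 1, L, m, K, hd, hL⟩ : Params) →ₗ[ℝ] BondSpace (⟨d + 1, L, m, K, hd, hL⟩ : Params))) ∘ₗ (GE (Domains.whole (P := (⟨d + 1, L, m, K, hd, hL⟩ : Params)) j hj') hc (w := fun _ => a * ((L : ℝ) ^ j) ^ (d + 1)) (fun _ => hw'))) (EuclideanSpace.single b₀' (1 : ℝ)) b₀| ≤ C₂ * Real.exp (-(δ₂ * torusSupNorm (Mk (⟨d + 1, L, m, K, hd, hL⟩ : Params) j) (rep (Mk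 (⟨d + 1, L, m, K, hd, hL⟩ : Params) j) (iterBlockOf j b₀.src) - rep (Mk (⟨d + 1, L, m, K, hd, hL⟩ : Params) j) y))) := by
    rw [adjoint_DGE_eq hj' hc hw']
    exact hcol m K j hj' hc hw' lam
  have hg := blockBound_mono hρ (LinearMap.adjoint (((((L : ℝ) ^ j) • (onE (LinearMap.funLeft ℝ ℝ (fun b : PBond (⟨d + 1, L, m, K, hd, hL⟩ : Params) 0 => (⟨b.src.shift lam, b.dir⟩ : PBond (⟨d + 1, L, m, K, hd, hL⟩ : Params) 0))) - LinearMap.id) : BondSpace (⟨d + 1, L, m, K, hd, hL⟩ : Params) →ₗ[ℝ] BondSpace (⟨d + 1, L, m, K, hd, hL⟩ : Params))) ∘ₗ (GE (Domains.whole (P := (⟨d + 1, L, m, K, hd, hL⟩ : Params)) j hj') hc (w := fun _ => a * ((L : ℝ) ^ j) ^ (d + 1)) (fun _ => hw')))) (fun b₀ : PBond (⟨d + 1, L, m, K, hd, hL⟩ : Params) 0 => iterBlockOf j b₀.src) (fun b₀ : PBond (⟨d + 1, L, m, K, hd, hL⟩ : Params) 0 => iterBlockOf j b₀.src) hC₂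 le_rfl (min_le_right δ₁ δ₂) hg'
  exact l2blk_of_blockBounds hρ (((((L : ℝ) ^ j) • (onE (LinearMap.funLeft ℝ ℝ (fun b : PBond (⟨d + 1, L, m, K, hd, hL⟩ : Params) 0 => (⟨b.src.shift lam, b.dir⟩ : PBond (⟨d + 1, L, m, K, hd, hL⟩ : Params) 0))) - LinearMap.id) : BondSpace (⟨d + 1, L, m, K, hd, hL⟩ : Params) →ₗ[ℝ] BondSpace (⟨d + 1, L, m, K, hd, hL⟩ : Params))) ∘ₗ (GE (Domains.whole (P := (⟨d + 1, L, m, K, hd, hL⟩ : Params)) j hj') hc (w := fun _ => a * ((L : ℝ) ^ j) ^ (d + 1)) (fun _ => hw'))) (fun b₀ : PBond (⟨d + 1, L, m, K, hd, hL⟩ : Params) 0 => iterBlockOf j b₀.src) (fun b₀ : PBond (⟨d + 1, L, m, K, hd, hL⟩ : Params) 0 => iterBlockOf j b₀.src) hC₁ hC₂ (by positivity) (by nlinarith) hf hg y y' v u hv hu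

open Classical in
/-- **THE `ℓ²`-BLOCK BOUND OF `G^{(w′)}∇_λ*`, UNIFORMLY** (rows: file 12's (1.110)₃ member; columns: file 8's (1.110)₂ member). [cite: Balaban1984PropagatorsI, Prop. 1.2 (1.110), (1.114) pp.35–36; Balaban1984PropagatorsII, p.246] -/
theorem l2blk_GEDadj_scaling (d L : ℕ) (hd : 1 ≤ d + 1) (hL : Odd L ∧ 1 < L) {a : ℝ} (ha : 0 < a) :
    ∃ δ : ℝ, 0 < δ ∧ ∃ C : ℝ, 0 ≤ C ∧ ∀ (m K j : ℕ)
      (hj' : j ≤ (⟨d + 1, L, m, K, hd, hL⟩ : Params).m + (⟨d + 1, L, m, K, hd, hL⟩ : Params).K) (hc : ((L : ℝ) ^ j) ≠ 0)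
      (hw' : (0 : ℝ) < a * ((L : ℝ) ^ j) ^ (d + 1)) (lam : Fin (d + 1))
      (y y' : Site (⟨d + 1, L, m, K, hd, hL⟩ : Params) j) (v u : BondSpace (⟨d + 1, L, m, K, hd, hL⟩ : Params))
      (_hv : ∀ b : PBond (⟨d + 1, L, m, K, hd, hL⟩ : Params) 0, iterBlockOf j b.src ≠ y → v b = 0) (_hu : ∀ b : PBond (⟨d + 1, L, m, K, hd, hL⟩ : Params) 0, iterBlockOf j b.src ≠ y' → u b = 0),
      |⟪v, ((GE (Domains.whole (P := (⟨d + 1, L, m, K, hd, hL⟩ : Params)) j hj') hc (w := fun _ => a * ((L : ℝ) ^ j) ^ (d + 1)) (fun _ => hw')) ∘ₗ ((((L : ℝ) ^ j) • (onE (LinearMap.funLeft ℝ ℝ (fun b : PBond (⟨d + 1, L, m, K, hd, hL⟩ : Params) 0 => (⟨b.src.unshift lam, b.dir⟩ : PBond (⟨d + 1, L, m, K, hd, hL⟩ : Params) 0))) - LinearMap.id) : BondSpace (⟨d + 1, L, m, K, hd, hL⟩ : Params) →ₗ[ℝ] BondSpace (⟨d + 1, L, m, K, hd, hL⟩ : Params))))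 u⟫_ℝ| ≤ C * Real.exp (-(δ * torusSupNorm (Mk (⟨d + 1, L, m, K, hd, hL⟩ : Params) j) (rep (Mk (⟨d + 1, L, m, K, hd, hL⟩ : Params) j) y - rep (Mk (⟨d + 1, L, m, K, hd, hL⟩ : Params) j) y'))) * (‖v‖ * ‖u‖) := by
  obtain ⟨δ₁, hδ₁, C₁, hC₁, hrow⟩ := blockBound_GEDadj_scaling d L hd hL ha
  obtain ⟨δ₂, hδ₂, C₂, hC₂, hcol⟩ := blockBound_DGE_scaling d L hd hL ha
  refine ⟨min δ₁ δ₂, lt_min hδ₁ hδ₂, C₁ + C₂, by positivity, ?_⟩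
  intro m K j hj' hc hw' lam y y' v u hv hu
  have hρ : IsPseudoDist (fun t t' : Site (⟨d + 1, L, m, K, hd, hL⟩ : Params) j => torusSupNorm (Mk (⟨d + 1, L, m, K, hd, hL⟩ : Params) j) (rep (Mk (⟨d + 1, L, m, K, hd, hL⟩ : Params) j) t - rep (Mk (⟨d + 1, L, m, K, hd, hL⟩ : Params) j) t')) := torusDist_isPseudoDist (Mk (⟨d + 1, L, m, K, hd, hL⟩ : Params) j)
  have hf := blockBound_mono hρ ((GE (Domains.whole (P := (⟨d + 1, L, m, K, hd, hL⟩ : Params)) j hj') hc (w := fun _ => a * ((L : ℝ) ^ j) ^ (d + 1)) (fun _ => hw')) ∘ₗ ((((L : ℝ) ^ j) • (onE (LinearMap.funLeft ℝ ℝ (fun b : PBond (⟨d + 1, L, m, K, hd, hL⟩ : Params) 0 => (⟨b.src.unshift lam, b.dir⟩ : PBond (⟨d + 1, L, m, K, hd, hL⟩ : Params) 0))) - LinearMap.id) : BondSpace (⟨d + 1, L, m, K, hd, hL⟩ : Params) →ₗ[ℝ] BondSpace (⟨d + 1, L, m, K, hd, hL⟩ : Params)))) (fun b₀ : PBond (⟨d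 + 1, L, m, K, hd, hL⟩ : Params) 0 => iterBlockOf j b₀.src) (fun b₀ : PBond (⟨d + 1, L, m, K, hd, hL⟩ : Params) 0 => iterBlockOf j b₀.src) hC₁ le_rfl (min_le_left δ₁ δ₂) (hrow m K j hj' hc hw' lam)
  have hg' : ∀ (b₀ : PBond (⟨d + 1, L, m, K, hd, hL⟩ : Params) 0) (y : Site (⟨d + 1, L, m, K, hd, hL⟩ : Params) j),
      ∑ b₀' ∈ univ.filter (fun b₀' : PBond (⟨d + 1, L, m, K, hd, hL⟩ : Params) 0 => iterBlockOf j b₀'.src = y),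
          |LinearMap.adjoint ((GE (Domains.whole (P := (⟨d + 1, L, m, K, hd, hL⟩ : Params)) j hj') hc (w := fun _ => a * ((L : ℝ) ^ j) ^ (d + 1)) (fun _ => hw')) ∘ₗ ((((L : ℝ) ^ j) • (onE (LinearMap.funLeft ℝ ℝ (fun b : PBond (⟨d + 1, L, m, K, hd, hL⟩ : Params) 0 => (⟨b.src.unshift lam, b.dir⟩ : PBond (⟨d + 1, L, m, K, hd, hL⟩ : Params) 0))) - LinearMap.id) : BondSpace (⟨d + 1, L, m, K, hd, hL⟩ : Params) →ₗ[ℝ] BondSpace (⟨d + 1, L, m, K, hd, hL⟩ : Params)))) (EuclideanSpace.single b₀' (1 : ℝ)) b₀| ≤ C₂ * Real.exp (-(δ₂ * torusSupNorm (Mk (⟨d + 1, L, m, K, hd, hL⟩ : Params) j) (rep (Mk (⟨d + 1, L, m, K, hd, hL⟩ : Params) j) (iterBlockOf j b₀.src) - rep (Mk (⟨d + 1, L, m, K, hd, hL⟩ : Params) j) y))) := by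
    rw [adjoint_GEDadj_eq hj' hc hw']
    exact hcol m K j hj' hc hw' lam
  have hg := blockBound_mono hρ (LinearMap.adjoint ((GE (Domains.whole (P := (⟨d + 1, L, m, K, hd, hL⟩ : Params)) j hj') hc (w := fun _ => a * ((L : ℝ) ^ j) ^ (d + 1)) (fun _ => hw')) ∘ₗ ((((L : ℝ) ^ j) • (onE (LinearMap.funLeft ℝ ℝ (fun b : PBond (⟨d + 1, L, m, K, hd, hL⟩ : Params) 0 => (⟨b.src.unshift lam, b.dir⟩ : PBond (⟨d + 1, L, m, K, hd, hL⟩ : Params) 0))) - LinearMap.id) : BondSpace (⟨d + 1, L, m, K, hd, hL⟩ : Params) →ₗ[ℝ] BondSpace (⟨d + 1, L, m, K, hd, hL⟩ : Params))))) (fun b₀ : PBond (⟨d + 1, L, m, K, hd, hL⟩ : Params) 0 => iterBlockOf j b₀.src) (fun b₀ : PBond (⟨d + 1, L, m, K, hd, hL⟩ : Params) 0 => iterBlockOf j b₀.src) hC₂ le_rfl (min_le_right δ₁ δ₂) hg'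
  exact l2blk_of_blockBounds hρ ((GE (Domains.whole (P := (⟨d + 1, L, m, K, hd, hL⟩ : Params)) j hj') hc (w := fun _ => a * ((L : ℝ) ^ j) ^ (d + 1)) (fun _ => hw')) ∘ₗ ((((L : ℝ) ^ j) • (onE (LinearMap.funLeft ℝ ℝ (fun b : PBond (⟨d + 1, L, m, K, hd, hL⟩ : Params) 0 => (⟨b.src.unshift lam, b.dir⟩ : PBond (⟨d + 1, L, m, K, hd, hL⟩ : Params) 0))) - LinearMap.id) : BondSpace (⟨d + 1, L, m, K, hd, hL⟩ : Params) →ₗ[ℝ] BondSpace (⟨d + 1, L, m, K, hd, hL⟩ : Params)))) (fun b₀ : PBond (⟨d + 1, L, m, K, hd, hL⟩ : Params) 0 => iterBlockOf j b₀.src) (fun b₀ : PBond (⟨d + 1, L, m, K, hd, hL⟩ : Params) 0 => iterBlockOf j b₀.src) hC₁ hC₂ (by positivity) (by nlinarith) hf hg y y' v u hv hu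

end L2

end Literature.MathematicalPhysics.QuantumFieldTheory.Balaban1983to89.B6L2BlockGradDivTermsV1

end
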